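import Mathlib.Analysis.Complex.SqrtDeriv
import Mathlib.Analysis.SpecialFunctions.Complex.LogDeriv
import Mathlib.Analysis.Normed.Module.RCLike.Real
import Literature.Analysis.Complex.ExtremalLength
import HarnessLib

/-!
# Extremal distance in the half plane: proof of Ahlfors's double inequality (4-21)

Topic: complex analysis / geometric function theory. This file discharges the named fact
`Literature.Analysis.Complex.halfPlane_extremalDistance_log_bounds` of `ExtremalLength.lean`
(Ahlfors, *Conformal Invariants* (1973), §4-12, (4-21) p. 76): for `e₂ < e₃ < e₁` and
`R = (e₁ - e₃)/(e₃ - e₂)`, the extremal distance `d` between `[e₂, e₃]` and `[e₁, +∞)` with respect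
to the upper half plane satisfies `log (16 R) ≤ π d ≤ log (16 (R + 1))`.

## The proof given here (elementary; not Ahlfors's)

Ahlfors obtains (4-21) from the product expansion of the elliptic modular function. We give
instead a self-contained extremal-length proof by comparison with explicitly computable
configurations, using only the tools of `ExtremalLength.lean` (the rectangle, the comparison
principle, one-sided conformal invariance):

1. `ExtremalLength.extremalDistance_halfAnnulus`: the extremal distance between the two half
   circles of the upper half annulus `1 < |z| < ρ, im z > 0` is `log ρ / π` (it is the image of the
   rectangle `(0, log ρ) × (0, π)` under `exp`).
2. `ExtremalLength.extremalDistance_halfEllipseDomain`: the Joukowski map `z ↦ z + 1/z` takes the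
   half annulus onto the upper half `D(ρ)` of the ellipse with semi-axes `ρ ± 1/ρ`, the inner half
   circle onto `[-2, 2]` and the outer one onto the upper half-ellipse; hence
   `d_{D(ρ)}([-2,2], half-ellipse) = log ρ / π`.
3. The upper half disk `S(P)` of radius `P` satisfies `D(ρ⁻) ⊆ S(P) ⊆ D(ρ⁺)` for
   `ρ⁻ + 1/ρ⁻ = P = ρ⁺ - 1/ρ⁺`, and a first-exit decomposition of paths (comparison principle) gives
   `log ρ⁻ / π ≤ d_{S(P)}([-2,2], upper half circle) ≤ log ρ⁺ / π`
   (`ExtremalLength.le_extremalDistance_upperHalfDisk`, `ExtremalLength.extremalDistance_upperHalfDisk_le`).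
4. The elementary conformal map `w ↦ -((P - w)/(P + w))²` of `S(P)` onto the upper half plane sends
   `[-2, 2]` onto `[-μ², -μ⁻²]`, `μ = (P+2)/(P-2)`, and the half circle onto `[0, +∞]`; so
   `d_ℍ([-μ², -μ⁻²], [0, ∞)) = d_{S(P)}([-2,2], half circle)`, and this configuration has
   `R = 1/(μ⁴ - 1) = (P-2)⁴ / (16 P (P² + 4))`.
5. Finally `16 R ≤ P - 1 ≤ ρ⁻` and `ρ⁺ ≤ P + 2 ≤ 16 (R + 1)`, and a real affine map reduces general
   `e₂ < e₃ < e₁` to this normal form.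

The comparison in step 3 is asymptotically sharp: it gives `e^{π d} = 16 R + 8 + O(1/R)`.

## References

* L. V. Ahlfors, *Conformal Invariants: Topics in Geometric Function Theory*, McGraw-Hill (1973),
  AMS Chelsea reprint (2010), §4-2 (annulus and rectangle), §§4-11–4-12, (4-21) p. 76.
  [Ahlfors1973CI]
-/

noncomputable section

open Set Filter Metric Topology MeasureTheory Complex Real
open UpperHalfPlane (upperHalfPlaneSet)
open scoped ENNReal NNReal ComplexOrder

namespace Literature.Analysis.Complex

open ExtremalLength

variable {Ω Ω' E₁ E₂ E₁' E₂' : Set ℂ} {γ : ℝ → ℂ} {ρ : ℂ → ℝ≥0∞}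

/-! ### Complements to `ExtremalLength.lean`: transport, sub-paths, first exit -/

namespace IsJoiningPath

/-- A joining path maps the closed parameter interval into `E₁ ∪ E₂ ∪ Ω`. [folklore] -/
theorem mapsTo_Icc (h : IsJoiningPath Ω E₁ E₂ γ) : MapsTo γ (Icc 0 1) (E₁ ∪ E₂ ∪ Ω) := by
  intro t ht
  rcases eq_or_lt_of_le ht.1 with h0 | h0
  · rw [← h0]; exact Or.inl (Or.inl h.source)
  rcases eq_or_lt_of_le ht.2 with h1 | h1
  · rw [h1]; exact Or.inl (Or.inr h.target)
  · exact Or.inr (h.mapsTo ⟨h0, h1⟩)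

/-- Variant of `IsJoiningPath.comp` in which `f` is only required to be continuous on
`E₁ ∪ E₂ ∪ Ω` (a set containing the whole path) instead of `closure Ω`. [folklore] -/
theorem comp' {f : ℂ → ℂ} (h : IsJoiningPath Ω E₁ E₂ γ) (hΩ : IsOpen Ω)
    (hf : DifferentiableOn ℂ f Ω) (hfc : ContinuousOn f (E₁ ∪ E₂ ∪ Ω)) (hmaps : MapsTo f Ω Ω') :
    IsJoiningPath Ω' (f '' E₁) (f '' E₂) (f ∘ γ) where
  continuousOn := hfc.comp h.continuousOn h.mapsTo_Icc
  differentiableOn := fun t ht ↦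
    ((hf.differentiableAt (hΩ.mem_nhds (h.mapsTo ht))).restrictScalars ℝ).comp_differentiableWithinAt
      t (h.differentiableOn t ht)
  source := mem_image_of_mem f h.source
  target := mem_image_of_mem f h.target
  mapsTo := hmaps.comp h.mapsTo

end IsJoiningPath

/-- One-sided conformal invariance (`extremalDistance_image_le`) with the continuity of `f`
required only on `E₁ ∪ E₂ ∪ Ω`. [cite: Ahlfors1973CI, §4-1 p. 51] -/
theorem extremalDistance_image_le' {f : ℂ → ℂ} (hΩ : IsOpen Ω) (hf : DifferentiableOn ℂ f Ω)
    (hinj : InjOn f Ω) (hfc : ContinuousOn f (E₁ ∪ E₂ ∪ Ω)) (hfΩ : f '' Ω = Ω') :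
    extremalDistance Ω' (f '' E₁) (f '' E₂) ≤ extremalDistance Ω E₁ E₂ := by
  subst hfΩ
  refine extremalLength_le_iff.2 fun ρ hρ h0 htop ↦ ?_
  have hmeas := measurable_pullbackMetric hΩ hf.continuousOn hρ
  have harea := area_pullbackMetric hΩ hf hinj ρ
  rw [← harea] at h0 htop ⊢
  refine le_trans (ENNReal.div_le_div_right (pow_le_pow_left' ?_ 2) _)
    (div_le_extremalLength hmeas h0 htop)
  refine le_minLength_iff.2 fun γ hγ ↦ ?_
  rw [← length_comp hΩ hf hγ.differentiableOn hγ.mapsTo ρ]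
  exact minLength_le (hγ.comp' hΩ hf hfc (mapsTo_image f Ω)) ρ

/-- **Transport of extremal distances along a conformal map**, in the form used below: if `f` is
holomorphic and injective on the open set `Ω`, continuous on `E₁ ∪ E₂ ∪ Ω`, `f(Ω) = Ω'`,
`f(E₁) ⊆ E₁'` and `f(E₂) ⊆ E₂'`, then `d_{Ω'}(E₁', E₂') ≤ d_Ω(E₁, E₂)`. [cite: Ahlfors1973CI, §4-1 p. 51] -/
theorem extremalDistance_le_of_mapsTo {f : ℂ → ℂ} (hΩ : IsOpen Ω) (hf : DifferentiableOn ℂ f Ω)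
    (hinj : InjOn f Ω) (hfc : ContinuousOn f (E₁ ∪ E₂ ∪ Ω)) (hfΩ : f '' Ω = Ω')
    (h₁ : MapsTo f E₁ E₁') (h₂ : MapsTo f E₂ E₂') :
    extremalDistance Ω' E₁' E₂' ≤ extremalDistance Ω E₁ E₂ :=
  (extremalDistance_anti h₁.image_subset h₂.image_subset).trans
    (extremalDistance_image_le' hΩ hf hinj hfc hfΩ)

namespace ExtremalLength

/-- **The `ρ`-length of a sub-path**: `L(γ|[u,v], ρ) = ∫_{(u,v)} ρ(γ) ‖γ'‖`. [folklore] -/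
theorem length_subpath {u v : ℝ} (huv : u < v) (ρ : ℂ → ℝ≥0∞) (γ : ℝ → ℂ) :
    length ρ (subpath γ u v) = ∫⁻ x in Ioo u v, ρ (γ x) * ‖deriv γ x‖ₑ := by
  have ha : 0 < v - u := sub_pos.2 huv
  unfold length
  calc ∫⁻ t in Ioo (0 : ℝ) 1, ρ (subpath γ u v t) * ‖deriv (subpath γ u v) t‖ₑ
      = ∫⁻ t in Ioo (0 : ℝ) 1, (fun x ↦ ρ (γ (u + x)) * ‖deriv γ (u + x)‖ₑ) ((v - u) * t)
          * ENNReal.ofReal (v - u) := by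
        refine setLIntegral_congr_fun measurableSet_Ioo fun t _ ↦ ?_
        rw [subpath_apply, deriv_subpath, enorm_smul, Real.enorm_eq_ofReal ha.le]
        ring
    _ = ENNReal.ofReal (v - u) * (ENNReal.ofReal (v - u)⁻¹ *
          ∫⁻ x in Ioo 0 (v - u), ρ (γ (u + x)) * ‖deriv γ (u + x)‖ₑ) := by
        rw [lintegral_mul_const' _ _ ENNReal.ofReal_ne_top,
          lintegral_Ioo_comp_mul (fun x ↦ ρ (γ (u + x)) * ‖deriv γ (u + x)‖ₑ) ha, mul_comm]
    _ = ∫⁻ x in Ioo u v, ρ (γ x) * ‖deriv γ x‖ₑ := by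
        rw [← mul_assoc, ← ENNReal.ofReal_mul ha.le, mul_inv_cancel₀ ha.ne', ENNReal.ofReal_one,
          one_mul, lintegral_Ioo_comp_add (fun x ↦ ρ (γ x) * ‖deriv γ x‖ₑ) u (v - u),
          add_sub_cancel]

/-- A sub-path is not longer than the path. [folklore] -/
theorem length_subpath_le {u v : ℝ} (h0 : 0 ≤ u) (huv : u < v) (h1 : v ≤ 1) (ρ : ℂ → ℝ≥0∞)
    (γ : ℝ → ℂ) : length ρ (subpath γ u v) ≤ length ρ γ := by
  rw [length_subpath huv]
  exact lintegral_mono_set (Ioo_subset_Ioo h0 h1)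

end ExtremalLength

/-- **First exit.** A path joining `E₁` to `E₂` within `Ω` that starts inside the open set `U` and
ends outside it has a first exit parameter `τ ∈ (0, 1]`: before `τ` the path is in `U`, and
`γ τ` lies on the frontier of `U` and in `Ω ∪ E₂`. [folklore] -/
theorem IsJoiningPath.exists_exit {U : Set ℂ} (h : IsJoiningPath Ω E₁ E₂ γ) (hU : IsOpen U)
    (h0 : γ 0 ∈ U) (h1 : γ 1 ∉ U) :
    ∃ τ ∈ Ioc (0 : ℝ) 1, MapsTo γ (Ico 0 τ) U ∧ γ τ ∈ frontier U ∧ γ τ ∈ Ω ∪ E₂ := by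
  set S : Set ℝ := Icc 0 1 ∩ γ ⁻¹' Uᶜ with hS
  have hSc : IsClosed S :=
    h.continuousOn.preimage_isClosed_of_isClosed isClosed_Icc hU.isClosed_compl
  have h1S : (1 : ℝ) ∈ S := ⟨⟨zero_le_one, le_rfl⟩, h1⟩
  have hbdd : BddBelow S := ⟨0, fun t ht ↦ ht.1.1⟩
  have hτS : sInf S ∈ S := hSc.csInf_mem ⟨1, h1S⟩ hbdd
  have hτ1 : sInf S ≤ 1 := csInf_le hbdd h1S
  have hτ0 : 0 < sInf S := by
    rcases eq_or_lt_of_le hτS.1.1 with h' | h'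
    · exact absurd h0 (by rw [h']; exact hτS.2)
    · exact h'
  have hbefore : MapsTo γ (Ico 0 (sInf S)) U := fun t ht ↦ by
    by_contra hc
    exact (not_le.2 ht.2) (csInf_le hbdd ⟨⟨ht.1, ht.2.le.trans hτ1⟩, hc⟩)
  refine ⟨sInf S, ⟨hτ0, hτ1⟩, hbefore, ?_, ?_⟩
  · rw [hU.frontier_eq]
    refine ⟨?_, hτS.2⟩
    have hcont : ContinuousWithinAt γ (Ico 0 (sInf S)) (sInf S) :=
      (h.continuousOn.continuousWithinAt ⟨hτ0.le, hτ1⟩).mono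
        fun t ht ↦ ⟨ht.1, ht.2.le.trans hτ1⟩
    have hmem : sInf S ∈ closure (Ico 0 (sInf S)) := by
      rw [closure_Ico hτ0.ne]
      exact right_mem_Icc.2 hτ0.le
    exact closure_mono hbefore.image_subset (hcont.mem_closure_image hmem)
  · rcases eq_or_lt_of_le hτ1 with h' | h'
    · rw [h']; exact Or.inr h.target
    · exact Or.inl (h.mapsTo ⟨hτ0, h'⟩)

/-- **Comparison by first exit** (Ahlfors (1973), Theorem 4-1: "every `γ ∈ Γ` contains a
`γ' ∈ Γ'`"): if `E₁` lies in the open set `U`, `E₂` avoids `U`, and `F₂` contains the frontier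
points of `U` in `Ω ∪ E₂`, then every path joining `E₁` to `E₂` within `Ω` contains an initial
sub-path joining `E₁` to `F₂` within `Ω ∩ U`, hence `d_{Ω ∩ U}(E₁, F₂) ≤ d_Ω(E₁, E₂)`. [cite: Ahlfors1973CI, Theorem 4-1 p. 54] -/
theorem extremalDistance_inter_le {U F₂ : Set ℂ} (hΩ : IsOpen Ω) (hU : IsOpen U) (hE₁ : E₁ ⊆ U)
    (hE₂ : Disjoint E₂ U) (hF₂ : frontier U ∩ (Ω ∪ E₂) ⊆ F₂) :
    extremalDistance (Ω ∩ U) E₁ F₂ ≤ extremalDistance Ω E₁ E₂ := by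
  refine extremalLength_le_of_subset (hΩ.inter hU).measurableSet inter_subset_left
    (fun γ hγ ↦ hγ.mapsTo) fun γ hγ ↦ ?_
  obtain ⟨τ, ⟨hτ0, hτ1⟩, hbefore, hfr, hmem⟩ :=
    hγ.exists_exit hU (hE₁ hγ.source) (Set.disjoint_left.1 hE₂ hγ.target)
  refine ⟨subpath γ 0 τ, hγ.subpath le_rfl hτ0 hτ1 hγ.source (hF₂ ⟨hfr, hmem⟩)
    (fun t ht ↦ ⟨hγ.mapsTo ⟨ht.1, ht.2.trans_le hτ1⟩, hbefore ⟨ht.1.le, ht.2⟩⟩), fun ρ _ ↦ ?_⟩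
  exact length_subpath_le le_rfl hτ0 hτ1 ρ γ

namespace ExtremalLength

/-! ### The principal square root on the closed upper half plane -/

/-- `(√z)² = z`. [folklore] -/
theorem sqrt_sq (z : ℂ) : Complex.sqrt z ^ 2 = z := by
  rw [Complex.sqrt]
  exact Complex.cpow_ofNat_inv_pow z 2

/-- The principal square root has non-negative real part. [folklore] -/
theorem sqrt_re_nonneg (z : ℂ) : 0 ≤ (Complex.sqrt z).re := by
  rw [Complex.sqrt, Complex.cpow_inv_two_re]
  exact Real.sqrt_nonneg _

/-- On the closed upper half plane the principal square root has non-negative imaginary part.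
[folklore] -/
theorem sqrt_im_nonneg {z : ℂ} (hz : 0 ≤ z.im) : 0 ≤ (Complex.sqrt z).im := by
  rw [Complex.sqrt, Complex.cpow_inv_two_im_eq_sqrt hz]
  exact Real.sqrt_nonneg _

/-- On the open upper half plane the principal square root has positive imaginary part.
[folklore] -/
theorem sqrt_im_pos {z : ℂ} (hz : 0 < z.im) : 0 < (Complex.sqrt z).im := by
  rw [Complex.sqrt, Complex.cpow_inv_two_im_eq_sqrt hz.le]
  apply Real.sqrt_pos.2
  have h := Complex.abs_re_lt_norm.2 hz.ne'
  have h' := le_abs_self z.re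
  linarith

/-- On the open upper half plane the principal square root has positive real part. [folklore] -/
theorem sqrt_re_pos {z : ℂ} (hz : 0 < z.im) : 0 < (Complex.sqrt z).re := by
  rw [Complex.sqrt, Complex.cpow_inv_two_re]
  apply Real.sqrt_pos.2
  have h := Complex.abs_re_lt_norm.2 hz.ne'
  have h' := neg_abs_le z.re
  linarith

/-- Two complex numbers with the same square and positive imaginary parts are equal. [folklore] -/
theorem eq_of_sq_eq_sq_of_im_pos {u v : ℂ} (h : u ^ 2 = v ^ 2) (hu : 0 < u.im) (hv : 0 < v.im) :
    u = v := by
  rcases sq_eq_sq_iff_eq_or_eq_neg.1 h with h' | h'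
  · exact h'
  · rw [h', Complex.neg_im] at hu
    linarith

/-- The principal square root of a point of the upper half plane is characterised as the square
root with positive imaginary part. [folklore] -/
theorem sqrt_eq_of_sq_eq {z u : ℂ} (hz : 0 < z.im) (hu : 0 < u.im) (h : u ^ 2 = z) :
    Complex.sqrt z = u :=
  eq_of_sq_eq_sq_of_im_pos (by rw [sqrt_sq, h]) (sqrt_im_pos hz) hu

/-- The principal logarithm is continuous within the closed upper half plane at every non-zero
point of it (also on the negative real axis, approached from above). [folklore] -/
theorem continuousWithinAt_log_of_ne_zero {z : ℂ} (hz : z ≠ 0) :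
    ContinuousWithinAt Complex.log {w : ℂ | 0 ≤ w.im} z := by
  by_cases h : z ∈ slitPlane
  · exact (continuousAt_clog h).continuousWithinAt
  · rw [Complex.mem_slitPlane_iff, not_or, not_lt, not_ne_iff] at h
    refine Complex.continuousWithinAt_log_of_re_neg_of_im_zero (lt_of_le_of_ne h.1 fun h0 ↦ hz ?_) h.2
    exact Complex.ext h0 h.2

/-- The principal square root is continuous within the closed upper half plane (also on the
negative real axis, approached from above). [folklore] -/
theorem continuousWithinAt_sqrt (z : ℂ) :
    ContinuousWithinAt Complex.sqrt {w : ℂ | 0 ≤ w.im} z := by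
  by_cases hz : z = 0
  · exact (Complex.continuousAt_sqrt (Or.inl (by rw [hz]; rfl))).continuousWithinAt
  have h2 : ContinuousWithinAt (fun w ↦ Complex.exp (Complex.log w / 2)) {w : ℂ | 0 ≤ w.im} z :=
    ((Complex.continuous_exp.comp (continuous_id.div_const 2)).continuousAt).comp_continuousWithinAt
      (continuousWithinAt_log_of_ne_zero hz)
  refine h2.congr_of_eventuallyEq ?_ (sqrt_eq_exp hz)
  have hne : ∀ᶠ w in 𝓝[{w : ℂ | 0 ≤ w.im}] z, w ≠ 0 :=
    mem_nhdsWithin_of_mem_nhds (isOpen_ne.mem_nhds hz)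
  exact hne.mono fun w hw ↦ sqrt_eq_exp hw

/-- The principal square root is continuous on the closed upper half plane. [folklore] -/
theorem continuousOn_sqrt_im_nonneg : ContinuousOn Complex.sqrt {w : ℂ | 0 ≤ w.im} :=
  fun z _ ↦ continuousWithinAt_sqrt z

/-- The principal square root is complex differentiable on the open upper half plane. [folklore] -/
theorem differentiableAt_sqrt_of_im_pos {z : ℂ} (hz : 0 < z.im) :
    DifferentiableAt ℂ Complex.sqrt z :=
  Complex.differentiableAt_sqrt (Complex.mem_slitPlane_iff.2 (Or.inr hz.ne'))

/-- `√x = √x` for real `x ≥ 0`. [folklore] -/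
theorem sqrt_ofReal {x : ℝ} (hx : 0 ≤ x) : Complex.sqrt (x : ℂ) = (Real.sqrt x : ℂ) := by
  rw [Complex.sqrt_of_nonneg (Complex.zero_le_real.2 hx), Complex.ofReal_re]

/-- `√(-x) = i √x` for real `x ≥ 0`. [folklore] -/
theorem sqrt_neg_ofReal {x : ℝ} (hx : 0 ≤ x) : Complex.sqrt (-(x : ℂ)) = I * Real.sqrt x := by
  rw [Complex.sqrt_neg_of_nonneg (Complex.zero_le_real.2 hx), sqrt_ofReal hx]

/-! ### The upper half annulus (Ahlfors §4-2: annulus and rectangle) -/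

/-- The upper half `H(ρ) = {1 < |z| < ρ, im z > 0}` of the annulus `1 < |z| < ρ`. [folklore] -/
def halfAnnulus (ρ : ℝ) : Set ℂ := {z | 1 < ‖z‖ ∧ ‖z‖ < ρ ∧ 0 < z.im}

/-- The closed upper half `C⁺(r) = {|z| = r, im z ≥ 0}` of the circle of radius `r` about `0`.
[folklore] -/
def upperArc (r : ℝ) : Set ℂ := {z | ‖z‖ = r ∧ 0 ≤ z.im}

/-- Membership in the half annulus. [folklore] -/
@[simp] theorem mem_halfAnnulus {ρ : ℝ} {z : ℂ} :
    z ∈ halfAnnulus ρ ↔ 1 < ‖z‖ ∧ ‖z‖ < ρ ∧ 0 < z.im := Iff.rfl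

/-- Membership in the upper arc. [folklore] -/
@[simp] theorem mem_upperArc {r : ℝ} {z : ℂ} : z ∈ upperArc r ↔ ‖z‖ = r ∧ 0 ≤ z.im := Iff.rfl

/-- The half annulus is open. [folklore] -/
theorem isOpen_halfAnnulus (ρ : ℝ) : IsOpen (halfAnnulus ρ) :=
  (isOpen_lt continuous_const continuous_norm).inter
    ((isOpen_lt continuous_norm continuous_const).inter (isOpen_lt continuous_const continuous_im))

/-- The half annulus lies in the upper half plane. [folklore] -/
theorem halfAnnulus_subset_upperHalfPlaneSet (ρ : ℝ) : halfAnnulus ρ ⊆ upperHalfPlaneSet :=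
  fun _ hz ↦ hz.2.2

/-- `0 < arg z < π` for `im z > 0`. [folklore] -/
theorem arg_mem_Ioo_of_im_pos {z : ℂ} (hz : 0 < z.im) : arg z ∈ Ioo 0 π := by
  refine ⟨lt_of_le_of_ne (Complex.arg_nonneg_iff.2 hz.le) fun h ↦ ?_,
    lt_of_le_of_ne (Complex.arg_le_pi z) fun h ↦ ?_⟩
  · exact hz.ne' (Complex.arg_eq_zero_iff.1 h.symm).2
  · exact hz.ne' (Complex.arg_eq_pi_iff.1 h).2

/-- **`exp` maps the rectangle `(0, log ρ) × (0, π)` onto the half annulus `H(ρ)`.** [folklore] -/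
theorem exp_image_rectangle {ρ : ℝ} (hρ : 1 < ρ) :
    Complex.exp '' (Ioo 0 (Real.log ρ) ×ℂ Ioo 0 π) = halfAnnulus ρ := by
  have hρ0 : 0 < ρ := one_pos.trans hρ
  ext z
  constructor
  · rintro ⟨w, hw, rfl⟩
    rw [mem_reProdIm] at hw
    refine ⟨?_, ?_, ?_⟩
    · rw [Complex.norm_exp]; exact Real.one_lt_exp_iff.2 hw.1.1
    · rw [Complex.norm_exp]; exact (Real.lt_log_iff_exp_lt hρ0).1 hw.1.2
    · rw [Complex.exp_im]
      exact mul_pos (Real.exp_pos _) (Real.sin_pos_of_pos_of_lt_pi hw.2.1 hw.2.2)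
  · rintro ⟨h1, h2, h3⟩
    have hz0 : z ≠ 0 := by rintro rfl; norm_num at h1
    refine ⟨Complex.log z, ?_, Complex.exp_log hz0⟩
    rw [mem_reProdIm, Complex.log_re, Complex.log_im]
    exact ⟨⟨Real.log_pos h1, Real.log_lt_log (by linarith) h2⟩, arg_mem_Ioo_of_im_pos h3⟩

/-- `exp` is injective on the rectangle `(0, log ρ) × (0, π)` (of height `< 2π`). [folklore] -/
theorem injOn_exp_rectangle (a : ℝ) : InjOn Complex.exp (Ioo 0 a ×ℂ Ioo 0 π) := by
  intro w₁ hw₁ w₂ hw₂ h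
  rw [mem_reProdIm] at hw₁ hw₂
  rw [← Complex.log_exp (by linarith [hw₁.2.1, Real.pi_pos]) hw₁.2.2.le,
    ← Complex.log_exp (by linarith [hw₂.2.1, Real.pi_pos]) hw₂.2.2.le, h]

/-- `exp` maps the vertical segment `{a} × [0, π]` into the upper half circle of radius `e^a`.
[folklore] -/
theorem exp_mapsTo_upperArc (a : ℝ) :
    MapsTo Complex.exp ({a} ×ℂ Icc 0 π) (upperArc (Real.exp a)) := by
  intro w hw
  rw [mem_reProdIm, mem_singleton_iff] at hw
  refine ⟨by rw [Complex.norm_exp, hw.1], ?_⟩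
  rw [Complex.exp_im]
  exact mul_nonneg (Real.exp_pos _).le (Real.sin_nonneg_of_nonneg_of_le_pi hw.2.1 hw.2.2)

/-- `log` maps the half annulus `H(ρ)` onto the rectangle `(0, log ρ) × (0, π)`. [folklore] -/
theorem log_image_halfAnnulus {ρ : ℝ} (hρ : 1 < ρ) :
    Complex.log '' halfAnnulus ρ = Ioo 0 (Real.log ρ) ×ℂ Ioo 0 π := by
  rw [← exp_image_rectangle hρ, image_image]
  refine EqOn.image_eq_self fun w hw ↦ ?_
  rw [mem_reProdIm] at hw
  exact Complex.log_exp (by linarith [hw.2.1, Real.pi_pos]) hw.2.2.le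

/-- `log` is injective on the half annulus. [folklore] -/
theorem injOn_log_halfAnnulus (ρ : ℝ) : InjOn Complex.log (halfAnnulus ρ) := by
  intro z₁ hz₁ z₂ hz₂ h
  have h₁ : z₁ ≠ 0 := by rintro rfl; simp at hz₁
  have h₂ : z₂ ≠ 0 := by rintro rfl; simp at hz₂
  rw [← Complex.exp_log h₁, ← Complex.exp_log h₂, h]

/-- `log` maps the upper half circle of radius `r > 0` into the segment `{log r} × [0, π]`.
[folklore] -/
theorem log_mapsTo_upperArc (r : ℝ) :
    MapsTo Complex.log (upperArc r) ({Real.log r} ×ℂ Icc 0 π) := by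
  intro z hz
  rw [mem_upperArc] at hz
  rw [mem_reProdIm, Complex.log_re, hz.1, Complex.log_im]
  exact ⟨rfl, Complex.arg_nonneg_iff.2 hz.2, Complex.arg_le_pi z⟩

/-- `log` is holomorphic on the half annulus. [folklore] -/
theorem differentiableOn_log_halfAnnulus (ρ : ℝ) : DifferentiableOn ℂ Complex.log (halfAnnulus ρ) :=
  fun _ hz ↦ (Complex.differentiableAt_log
    (Complex.mem_slitPlane_iff.2 (Or.inr hz.2.2.ne'))).differentiableWithinAt

/-- `log` is continuous on any subset of the closed upper half plane avoiding `0`. [folklore] -/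
theorem continuousOn_log_of_subset {S : Set ℂ} (hS : S ⊆ {w : ℂ | 0 ≤ w.im}) (h0 : (0 : ℂ) ∉ S) :
    ContinuousOn Complex.log S :=
  fun _ hz ↦ (continuousWithinAt_log_of_ne_zero (fun h ↦ h0 (h ▸ hz))).mono hS

/-- **The extremal distance between the two half circles of the upper half annulus
`1 < |z| < ρ, im z > 0` is `log ρ / π`** (Ahlfors (1973), §4-2: the configuration is the image
of the rectangle `(0, log ρ) × (0, π)` under `exp`, whose inverse `log` is continuous on the closed
half annulus). [cite: Ahlfors1973CI, §4-2 p. 53] -/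
theorem extremalDistance_halfAnnulus {ρ : ℝ} (hρ : 1 < ρ) :
    extremalDistance (halfAnnulus ρ) (upperArc 1) (upperArc ρ) = ENNReal.ofReal (Real.log ρ / π) := by
  have hρ0 : 0 < ρ := one_pos.trans hρ
  have hlog : 0 < Real.log ρ := Real.log_pos hρ
  rw [← extremalDistance_rectangle hlog Real.pi_pos]
  refine le_antisymm ?_ ?_
  · -- `exp : rectangle → half annulus`
    refine extremalDistance_le_of_mapsTo (isOpen_Ioo.reProdIm isOpen_Ioo)
      Complex.differentiable_exp.differentiableOn (injOn_exp_rectangle _)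
      Complex.continuous_exp.continuousOn (exp_image_rectangle hρ) ?_ ?_
    · simpa using exp_mapsTo_upperArc 0
    · simpa [Real.exp_log hρ0] using exp_mapsTo_upperArc (Real.log ρ)
  · -- `log : half annulus → rectangle`
    refine extremalDistance_le_of_mapsTo (isOpen_halfAnnulus ρ) (differentiableOn_log_halfAnnulus ρ)
      (injOn_log_halfAnnulus ρ) (continuousOn_log_of_subset ?_ ?_) (log_image_halfAnnulus hρ)
      (by simpa using log_mapsTo_upperArc 1) (log_mapsTo_upperArc ρ)
    · rintro z ((hz | hz) | hz)
      · exact hz.2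
      · exact hz.2
      · exact hz.2.2.le
    · rintro ((hz | hz) | hz)
      · simp at hz
      · simp only [mem_upperArc, norm_zero] at hz; linarith [hz.1]
      · simp at hz

/-! ### The Joukowski map and the half-ellipse domain -/

/-- The **Joukowski map** `J(z) = z + 1/z`. [folklore] -/
def joukowski (z : ℂ) : ℂ := z + z⁻¹

/-- The **inverse Joukowski map** on the closed upper half plane,
`g(w) = (w + √(w - 2) √(w + 2)) / 2` with principal square roots: the root of `z² - w z + 1 = 0`
lying in the closed upper half plane outside the unit disk. [folklore] -/
def joukowskiInv (w : ℂ) : ℂ := (w + Complex.sqrt (w - 2) * Complex.sqrt (w + 2)) / 2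

/-- The upper half `D(ρ)` of the inside of the ellipse with semi-axes `ρ + 1/ρ`, `ρ - 1/ρ` (the
Joukowski image of the half annulus `H(ρ)`). [folklore] -/
def halfEllipseDomain (ρ : ℝ) : Set ℂ :=
  {w | 0 < w.im ∧ (w.re / (ρ + ρ⁻¹)) ^ 2 + (w.im / (ρ - ρ⁻¹)) ^ 2 < 1}

/-- The closed upper half of the ellipse with semi-axes `ρ + 1/ρ`, `ρ - 1/ρ` (the Joukowski image
of the upper half circle of radius `ρ`). [folklore] -/
def upperHalfEllipse (ρ : ℝ) : Set ℂ :=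
  {w | 0 ≤ w.im ∧ (w.re / (ρ + ρ⁻¹)) ^ 2 + (w.im / (ρ - ρ⁻¹)) ^ 2 = 1}

/-- Membership in the half-ellipse domain. [folklore] -/
@[simp] theorem mem_halfEllipseDomain {ρ : ℝ} {w : ℂ} : w ∈ halfEllipseDomain ρ ↔
    0 < w.im ∧ (w.re / (ρ + ρ⁻¹)) ^ 2 + (w.im / (ρ - ρ⁻¹)) ^ 2 < 1 := Iff.rfl

/-- Membership in the upper half-ellipse. [folklore] -/
@[simp] theorem mem_upperHalfEllipse {ρ : ℝ} {w : ℂ} : w ∈ upperHalfEllipse ρ ↔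
    0 ≤ w.im ∧ (w.re / (ρ + ρ⁻¹)) ^ 2 + (w.im / (ρ - ρ⁻¹)) ^ 2 = 1 := Iff.rfl

/-- The half-ellipse domain is open. [folklore] -/
theorem isOpen_halfEllipseDomain (ρ : ℝ) : IsOpen (halfEllipseDomain ρ) :=
  (isOpen_lt continuous_const continuous_im).inter
    (isOpen_lt (show Continuous fun w : ℂ ↦ (w.re / (ρ + ρ⁻¹)) ^ 2 + (w.im / (ρ - ρ⁻¹)) ^ 2 by
      fun_prop) continuous_const)

section RealLemmas

variable {r ρ : ℝ}

/-- `1 < ρ` gives `0 < ρ - 1/ρ`. [folklore] -/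
theorem sub_inv_pos (hρ : 1 < ρ) : 0 < ρ - ρ⁻¹ := by
  have : ρ⁻¹ < 1 := inv_lt_one_of_one_lt₀ hρ
  linarith

/-- `1 < ρ` gives `2 < ρ + 1/ρ`. [folklore] -/
theorem two_lt_add_inv (hρ : 1 < ρ) : 2 < ρ + ρ⁻¹ := by
  have h0 : 0 < ρ := one_pos.trans hρ
  have h1 : 0 < ρ - 1 := sub_pos.2 hρ
  have h : 0 < (ρ - 1) ^ 2 / ρ := by positivity
  have h' : (ρ - 1) ^ 2 / ρ = ρ + ρ⁻¹ - 2 := by field_simp; ring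
  linarith

/-- `x + 1/x` is monotone on `[1, ∞)`. [folklore] -/
theorem add_inv_le_add_inv (hr : 1 ≤ r) (h : r ≤ ρ) : r + r⁻¹ ≤ ρ + ρ⁻¹ := by
  have hr0 : 0 < r := one_pos.trans_le hr
  have hρ0 : 0 < ρ := hr0.trans_le h
  have key : ρ + ρ⁻¹ - (r + r⁻¹) = (ρ - r) * (1 - (ρ * r)⁻¹) := by field_simp; ring
  have h1 : 1 ≤ ρ * r := by nlinarith
  have h2 : 0 ≤ 1 - (ρ * r)⁻¹ := by
    have := inv_le_one_of_one_le₀ h1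
    linarith
  nlinarith [mul_nonneg (sub_nonneg.2 h) h2]

/-- `x - 1/x` is strictly monotone on `(0, ∞)`. [folklore] -/
theorem sub_inv_lt_sub_inv (hr : 0 < r) (h : r < ρ) : r - r⁻¹ < ρ - ρ⁻¹ := by
  have := inv_strictAnti₀ hr h
  linarith

/-- `x - 1/x` is monotone on `(0, ∞)`. [folklore] -/
theorem sub_inv_le_sub_inv (hr : 0 < r) (h : r ≤ ρ) : r - r⁻¹ ≤ ρ - ρ⁻¹ := by
  have := inv_anti₀ hr h
  linarith

/-- Monotonicity of the ellipse gauge in the semi-axes. [folklore] -/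
theorem ellipse_gauge_mono {X Y a b a' b' : ℝ} (ha : 0 < a) (hb : 0 < b) (haa : a ≤ a')
    (hbb : b ≤ b') : (X / a') ^ 2 + (Y / b') ^ 2 ≤ (X / a) ^ 2 + (Y / b) ^ 2 := by
  rw [div_pow, div_pow, div_pow, div_pow]
  exact add_le_add (div_le_div_of_nonneg_left (sq_nonneg X) (pow_pos ha 2) (by gcongr))
    (div_le_div_of_nonneg_left (sq_nonneg Y) (pow_pos hb 2) (by gcongr))

/-- Strict monotonicity of the ellipse gauge in the minor semi-axis, off the major axis.
[folklore] -/
theorem ellipse_gauge_strictMono {X Y a b a' b' : ℝ} (ha : 0 < a) (hb : 0 < b) (haa : a ≤ a')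
    (hbb : b < b') (hY : Y ≠ 0) : (X / a') ^ 2 + (Y / b') ^ 2 < (X / a) ^ 2 + (Y / b) ^ 2 := by
  rw [div_pow, div_pow, div_pow, div_pow]
  exact add_lt_add_of_le_of_lt (div_le_div_of_nonneg_left (sq_nonneg X) (pow_pos ha 2) (by gcongr))
    (div_lt_div_of_pos_left (by positivity) (pow_pos hb 2) (by gcongr))

end RealLemmas

/-- Real and imaginary parts of the Joukowski map. [folklore] -/
theorem joukowski_re_im (z : ℂ) : (joukowski z).re = z.re * (1 + (‖z‖ ^ 2)⁻¹) ∧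
    (joukowski z).im = z.im * (1 - (‖z‖ ^ 2)⁻¹) := by
  simp only [joukowski, add_re, add_im, inv_re, inv_im, Complex.normSq_eq_norm_sq]
  constructor <;> ring

/-- `re² + im² = |z|²` in the normalised form `(re/|z|)² + (im/|z|)² = 1`. [folklore] -/
theorem sq_re_div_norm_add_sq_im_div_norm {z : ℂ} (hz : z ≠ 0) :
    (z.re / ‖z‖) ^ 2 + (z.im / ‖z‖) ^ 2 = 1 := by
  have hr : 0 < ‖z‖ := norm_pos_iff.2 hz
  have h : ‖z‖ ^ 2 = z.re ^ 2 + z.im ^ 2 := by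
    rw [← Complex.normSq_eq_norm_sq, Complex.normSq_apply]; ring
  field_simp
  linarith

/-- The Joukowski map takes the circle `|z| = r` to the ellipse with semi-axes `r + 1/r`,
`|r - 1/r|`: real part. [folklore] -/
theorem joukowski_re_div {z : ℂ} (hz : z ≠ 0) :
    (joukowski z).re / (‖z‖ + ‖z‖⁻¹) = z.re / ‖z‖ := by
  have hr : 0 < ‖z‖ := norm_pos_iff.2 hz
  rw [(joukowski_re_im z).1, show (1 + (‖z‖ ^ 2)⁻¹) = (‖z‖ + ‖z‖⁻¹) / ‖z‖ by field_simp]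
  have ha : ‖z‖ + ‖z‖⁻¹ ≠ 0 := by positivity
  field_simp

/-- The Joukowski map takes the circle `|z| = r ≠ 1` to the ellipse with semi-axes `r + 1/r`,
`|r - 1/r|`: imaginary part. [folklore] -/
theorem joukowski_im_div {z : ℂ} (hz : z ≠ 0) (h1 : ‖z‖ ≠ 1) :
    (joukowski z).im / (‖z‖ - ‖z‖⁻¹) = z.im / ‖z‖ := by
  have hr : 0 < ‖z‖ := norm_pos_iff.2 hz
  have hb : ‖z‖ - ‖z‖⁻¹ ≠ 0 := by
    intro h
    have h' : ‖z‖ ^ 2 = 1 := by field_simp at h; linarith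
    exact h1 (by nlinarith [sq_nonneg (‖z‖ - 1), sq_nonneg (‖z‖ + 1)])
  have hb2 : ‖z‖ ^ 2 - 1 ≠ 0 := by
    rw [show ‖z‖ ^ 2 - 1 = ‖z‖ * (‖z‖ - ‖z‖⁻¹) by rw [mul_sub, mul_inv_cancel₀ hr.ne']; ring]
    exact mul_ne_zero hr.ne' hb
  rw [(joukowski_re_im z).2, show (1 - (‖z‖ ^ 2)⁻¹) = (‖z‖ - ‖z‖⁻¹) / ‖z‖ by field_simp]
  field_simp

/-- **The Joukowski image of the circle `|z| = r` (`r ≠ 1`) lies on the ellipse with semi-axes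
`r + 1/r`, `r - 1/r`.** [folklore] -/
theorem joukowski_mem_ellipse {z : ℂ} (hz : z ≠ 0) (h1 : ‖z‖ ≠ 1) :
    ((joukowski z).re / (‖z‖ + ‖z‖⁻¹)) ^ 2 + ((joukowski z).im / (‖z‖ - ‖z‖⁻¹)) ^ 2 = 1 := by
  rw [joukowski_re_div hz, joukowski_im_div hz h1, sq_re_div_norm_add_sq_im_div_norm hz]

/-- The Joukowski map sends the half annulus `H(ρ)` into the half-ellipse domain `D(ρ)`.
[folklore] -/
theorem joukowski_mapsTo_halfEllipseDomain (ρ : ℝ) :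
    MapsTo joukowski (halfAnnulus ρ) (halfEllipseDomain ρ) := by
  rintro z ⟨h1, h2, h3⟩
  have hz : z ≠ 0 := by rintro rfl; norm_num at h1
  have hr : 0 < ‖z‖ := norm_pos_iff.2 hz
  have hY : 0 < (joukowski z).im := by
    rw [(joukowski_re_im z).2]
    refine mul_pos h3 ?_
    have : (‖z‖ ^ 2)⁻¹ < 1 := inv_lt_one_of_one_lt₀ (by nlinarith)
    linarith
  refine ⟨hY, ?_⟩
  calc ((joukowski z).re / (ρ + ρ⁻¹)) ^ 2 + ((joukowski z).im / (ρ - ρ⁻¹)) ^ 2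
      < ((joukowski z).re / (‖z‖ + ‖z‖⁻¹)) ^ 2 + ((joukowski z).im / (‖z‖ - ‖z‖⁻¹)) ^ 2 :=
        ellipse_gauge_strictMono (by positivity) (sub_inv_pos h1) (add_inv_le_add_inv h1.le h2.le)
          (sub_inv_lt_sub_inv hr h2) hY.ne'
    _ = 1 := joukowski_mem_ellipse hz h1.ne'

/-- The Joukowski map sends the upper unit half circle into the segment `[-2, 2]`. [folklore] -/
theorem joukowski_mapsTo_segment : MapsTo joukowski (upperArc 1) (Icc (-2) 2 ×ℂ {0}) := by
  rintro z ⟨h1, -⟩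
  have h := joukowski_re_im z
  have hre := abs_le.1 (Complex.abs_re_le_norm z)
  rw [h1] at hre
  rw [mem_reProdIm, h.1, h.2, h1, mem_singleton_iff]
  norm_num
  constructor <;> linarith [hre.1, hre.2]

/-- The Joukowski map sends the upper half circle of radius `ρ > 1` into the upper half-ellipse.
[folklore] -/
theorem joukowski_mapsTo_upperHalfEllipse {ρ : ℝ} (hρ : 1 < ρ) :
    MapsTo joukowski (upperArc ρ) (upperHalfEllipse ρ) := by
  rintro z ⟨h1, h2⟩
  subst h1
  have hz : z ≠ 0 := by rintro rfl; norm_num at hρ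
  refine ⟨?_, joukowski_mem_ellipse hz hρ.ne'⟩
  rw [(joukowski_re_im z).2]
  refine mul_nonneg h2 ?_
  have : (‖z‖ ^ 2)⁻¹ < 1 := inv_lt_one_of_one_lt₀ (by nlinarith)
  linarith

/-- The Joukowski map is injective on the half annulus (indeed on `|z| > 1`). [folklore] -/
theorem injOn_joukowski (ρ : ℝ) : InjOn joukowski (halfAnnulus ρ) := by
  rintro z₁ ⟨h1, -, -⟩ z₂ ⟨h2, -, -⟩ h
  have hz₁ : z₁ ≠ 0 := by rintro rfl; norm_num at h1
  have hz₂ : z₂ ≠ 0 := by rintro rfl; norm_num at h2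
  unfold joukowski at h
  have key : (z₁ - z₂) * (z₁ * z₂ - 1) = 0 := by
    have h' : z₁ * z₁ * z₂ + z₂ = z₂ * z₂ * z₁ + z₁ := by
      have := congrArg (fun w ↦ w * (z₁ * z₂)) h
      simp only [add_mul] at this
      rw [show z₁⁻¹ * (z₁ * z₂) = z₂ by field_simp, show z₂⁻¹ * (z₁ * z₂) = z₁ by field_simp] at this
      linear_combination this
    linear_combination h'
  rcases mul_eq_zero.1 key with h0 | h0
  · exact sub_eq_zero.1 h0
  · exfalso
    have h12 : ‖z₁ * z₂‖ = 1 := by rw [sub_eq_zero.1 h0, norm_one]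
    rw [norm_mul] at h12
    nlinarith

/-- The Joukowski map is holomorphic away from `0`, in particular on the half annulus. [folklore] -/
theorem differentiableOn_joukowski (ρ : ℝ) : DifferentiableOn ℂ joukowski (halfAnnulus ρ) := by
  intro z hz
  have hz0 : z ≠ 0 := by rintro rfl; norm_num at hz
  exact (differentiableAt_id.add (differentiableAt_inv hz0)).differentiableWithinAt

/-- The Joukowski map is continuous on any set avoiding `0`. [folklore] -/
theorem continuousOn_joukowski {S : Set ℂ} (hS : (0 : ℂ) ∉ S) : ContinuousOn joukowski S := by
  intro z hz
  have hz0 : z ≠ 0 := fun h ↦ hS (h ▸ hz)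
  exact (continuousAt_id.add (continuousAt_inv₀ hz0)).continuousWithinAt

/-- `√(w-2) √(w+2)` is a square root of `w² - 4`. [folklore] -/
theorem sqrt_mul_sqrt_sq (w : ℂ) : (Complex.sqrt (w - 2) * Complex.sqrt (w + 2)) ^ 2 = w ^ 2 - 4 := by
  rw [mul_pow, sqrt_sq, sqrt_sq]; ring

/-- On the open upper half plane `√(w-2) √(w+2)` has positive imaginary part. [folklore] -/
theorem sqrt_mul_sqrt_im_pos {w : ℂ} (hw : 0 < w.im) :
    0 < (Complex.sqrt (w - 2) * Complex.sqrt (w + 2)).im := by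
  have h1 : 0 < (w - 2).im := by simpa using hw
  have h2 : 0 < (w + 2).im := by simpa using hw
  rw [mul_im]
  exact add_pos (mul_pos (sqrt_re_pos h1) (sqrt_im_pos h2)) (mul_pos (sqrt_im_pos h1) (sqrt_re_pos h2))

/-- On the closed upper half plane `√(w-2) √(w+2)` has non-negative imaginary part. [folklore] -/
theorem sqrt_mul_sqrt_im_nonneg {w : ℂ} (hw : 0 ≤ w.im) :
    0 ≤ (Complex.sqrt (w - 2) * Complex.sqrt (w + 2)).im := by
  have h1 : 0 ≤ (w - 2).im := by simpa using hw
  have h2 : 0 ≤ (w + 2).im := by simpa using hw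
  rw [mul_im]
  exact add_nonneg (mul_nonneg (sqrt_re_nonneg _) (sqrt_im_nonneg h2))
    (mul_nonneg (sqrt_im_nonneg h1) (sqrt_re_nonneg _))

/-- `g(w)` is a root of `z² - w z + 1`. [folklore] -/
theorem joukowskiInv_quadratic (w : ℂ) : joukowskiInv w ^ 2 - w * joukowskiInv w + 1 = 0 := by
  have h := sqrt_mul_sqrt_sq w
  unfold joukowskiInv
  linear_combination (1 / 4 : ℂ) * h

/-- `g(w) ≠ 0`. [folklore] -/
theorem joukowskiInv_ne_zero (w : ℂ) : joukowskiInv w ≠ 0 := fun h ↦ by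
  have := joukowskiInv_quadratic w
  rw [h] at this
  norm_num at this

/-- **`J(g(w)) = w`** for every `w`. [folklore] -/
theorem joukowski_joukowskiInv (w : ℂ) : joukowski (joukowskiInv w) = w := by
  have hq := joukowskiInv_quadratic w
  have h0 := joukowskiInv_ne_zero w
  unfold joukowski
  have h1 : joukowskiInv w * (joukowskiInv w + (joukowskiInv w)⁻¹ - w) = 0 := by
    rw [mul_sub, mul_add, mul_inv_cancel₀ h0]
    linear_combination hq
  rcases mul_eq_zero.1 h1 with h | h
  · exact absurd h h0
  · exact sub_eq_zero.1 h

/-- `g` is injective (it has the left inverse `J`). [folklore] -/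
theorem injective_joukowskiInv : Function.Injective joukowskiInv :=
  Function.LeftInverse.injective (g := joukowski) joukowski_joukowskiInv

/-- The imaginary part of `g(w)`. [folklore] -/
theorem joukowskiInv_im (w : ℂ) :
    (joukowskiInv w).im = (w.im + (Complex.sqrt (w - 2) * Complex.sqrt (w + 2)).im) / 2 := by
  simp [joukowskiInv, add_im]

/-- **`g(J(z)) = z`** for `z` in the upper half plane with `J(z)` in the upper half plane
(equivalently `|z| > 1`). [folklore] -/
theorem joukowskiInv_joukowski {z : ℂ} (hz : 0 < z.im) (hJ : 0 < (joukowski z).im) :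
    joukowskiInv (joukowski z) = z := by
  have hz0 : z ≠ 0 := by rintro rfl; simp at hz
  have hs : Complex.sqrt (joukowski z - 2) * Complex.sqrt (joukowski z + 2) = z - z⁻¹ := by
    apply eq_of_sq_eq_sq_of_im_pos
    · rw [sqrt_mul_sqrt_sq]
      unfold joukowski
      have : z * z⁻¹ = 1 := mul_inv_cancel₀ hz0
      linear_combination (4 : ℂ) * this
    · exact sqrt_mul_sqrt_im_pos hJ
    · rw [sub_im, inv_im]
      have h1 := Complex.normSq_pos.2 hz0
      have h2 : 0 < z.im / Complex.normSq z := div_pos hz h1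
      have h3 : -z.im / Complex.normSq z = -(z.im / Complex.normSq z) := by ring
      linarith
  unfold joukowskiInv
  rw [hs]
  unfold joukowski
  ring

/-- `im J(z) > 0` forces `|z| > 1` for `z` in the upper half plane. [folklore] -/
theorem one_lt_norm_of_joukowski_im_pos {z : ℂ} (hz : 0 < z.im) (hJ : 0 < (joukowski z).im) :
    1 < ‖z‖ := by
  rw [(joukowski_re_im z).2, mul_pos_iff_of_pos_left hz, sub_pos] at hJ
  have hz0 : 0 < ‖z‖ := norm_pos_iff.2 (by rintro rfl; simp at hz)
  have h1 : 1 < ‖z‖ ^ 2 := by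
    by_contra h
    push Not at h
    have := one_le_inv_iff₀.2 ⟨by positivity, h⟩
    linarith
  nlinarith

/-- `g` maps the half-ellipse domain `D(ρ)` into the half annulus `H(ρ)`. [folklore] -/
theorem joukowskiInv_mapsTo_halfAnnulus {ρ : ℝ} (hρ : 1 < ρ) :
    MapsTo joukowskiInv (halfEllipseDomain ρ) (halfAnnulus ρ) := by
  rintro w ⟨hw, hell⟩
  have hJ : joukowski (joukowskiInv w) = w := joukowski_joukowskiInv w
  have hzim : 0 < (joukowskiInv w).im := by
    rw [joukowskiInv_im]
    linarith [sqrt_mul_sqrt_im_pos hw]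
  have hr1 : 1 < ‖joukowskiInv w‖ := one_lt_norm_of_joukowski_im_pos hzim (by rwa [hJ])
  refine ⟨hr1, ?_, hzim⟩
  by_contra h
  push Not at h
  have hz0 : joukowskiInv w ≠ 0 := joukowskiInv_ne_zero w
  have hell' := joukowski_mem_ellipse hz0 hr1.ne'
  rw [hJ] at hell'
  have hmono := ellipse_gauge_mono (X := w.re) (Y := w.im) (by positivity) (sub_inv_pos hρ)
    (add_inv_le_add_inv hρ.le h) (sub_inv_le_sub_inv (one_pos.trans hρ) h)
  linarith

/-- **The Joukowski map takes the half annulus `H(ρ)` onto the half-ellipse domain `D(ρ)`.**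
[folklore] -/
theorem joukowski_image_halfAnnulus {ρ : ℝ} (hρ : 1 < ρ) :
    joukowski '' halfAnnulus ρ = halfEllipseDomain ρ := by
  refine (joukowski_mapsTo_halfEllipseDomain ρ).image_subset.antisymm fun w hw ↦ ?_
  exact ⟨joukowskiInv w, joukowskiInv_mapsTo_halfAnnulus hρ hw, joukowski_joukowskiInv w⟩

/-- **`g` takes the half-ellipse domain `D(ρ)` onto the half annulus `H(ρ)`.** [folklore] -/
theorem joukowskiInv_image_halfEllipseDomain {ρ : ℝ} (hρ : 1 < ρ) :
    joukowskiInv '' halfEllipseDomain ρ = halfAnnulus ρ := by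
  refine (joukowskiInv_mapsTo_halfAnnulus hρ).image_subset.antisymm fun z hz ↦ ?_
  have hD := joukowski_mapsTo_halfEllipseDomain ρ hz
  exact ⟨joukowski z, hD, joukowskiInv_joukowski hz.2.2 hD.1⟩

/-- `g` maps the segment `[-2, 2]` into the upper unit half circle:
`g(x) = (x + i √(4 - x²)) / 2`. [folklore] -/
theorem joukowskiInv_mapsTo_upperArc_one : MapsTo joukowskiInv (Icc (-2) 2 ×ℂ {0}) (upperArc 1) := by
  intro w hw
  rw [mem_reProdIm, mem_singleton_iff] at hw
  obtain ⟨⟨hx1, hx2⟩, him⟩ := hw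
  have hw' : w = (w.re : ℂ) := by
    apply Complex.ext <;> simp [him]
  set x := w.re with hx
  have hs : Complex.sqrt (w - 2) * Complex.sqrt (w + 2) = I * (Real.sqrt (4 - x ^ 2) : ℝ) := by
    rw [hw', show (x : ℂ) - 2 = -((2 - x : ℝ) : ℂ) by push_cast; ring,
      show (x : ℂ) + 2 = ((x + 2 : ℝ) : ℂ) by push_cast; ring,
      sqrt_neg_ofReal (by linarith), sqrt_ofReal (by linarith), mul_assoc, ← Complex.ofReal_mul,
      ← Real.sqrt_mul (by linarith), show (2 - x) * (x + 2) = 4 - x ^ 2 by ring]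
  have hg : joukowskiInv w = ((x / 2 : ℝ) : ℂ) + ((Real.sqrt (4 - x ^ 2) / 2 : ℝ) : ℂ) * I := by
    unfold joukowskiInv
    rw [hs, hw']
    push_cast
    ring
  rw [hg, mem_upperArc, Complex.norm_add_mul_I]
  constructor
  · have h4 : (x / 2) ^ 2 + (Real.sqrt (4 - x ^ 2) / 2) ^ 2 = 1 := by
      rw [div_pow, div_pow, Real.sq_sqrt (by nlinarith)]; ring
    rw [h4, Real.sqrt_one]
  · simp only [add_im, ofReal_im, mul_im, ofReal_re, I_im, I_re, mul_zero, mul_one, zero_add,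
      add_zero]
    positivity

/-- `g` maps the upper half-ellipse into the upper half circle of radius `ρ`. [folklore] -/
theorem joukowskiInv_mapsTo_upperArc {ρ : ℝ} (hρ : 1 < ρ) :
    MapsTo joukowskiInv (upperHalfEllipse ρ) (upperArc ρ) := by
  have hρ0 : 0 < ρ := one_pos.trans hρ
  have ha0 : 0 < ρ + ρ⁻¹ := by positivity
  have hb0 : 0 < ρ - ρ⁻¹ := sub_inv_pos hρ
  have ha2 : 2 < ρ + ρ⁻¹ := two_lt_add_inv hρ
  have hab : (ρ - ρ⁻¹) ^ 2 = (ρ + ρ⁻¹) ^ 2 - 4 := by field_simp; ring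
  rintro w ⟨him, hell⟩
  rcases him.eq_or_lt with h0 | hpos
  · -- on the real axis: `w = ± (ρ + 1/ρ)`
    have hre : w.re ^ 2 = (ρ + ρ⁻¹) ^ 2 := by
      rw [← h0, zero_div, zero_pow two_ne_zero, add_zero, div_pow,
        div_eq_one_iff_eq (pow_pos ha0 2).ne'] at hell
      exact hell
    have hw' : w = (w.re : ℂ) := by apply Complex.ext <;> simp [← h0]
    rcases sq_eq_sq_iff_eq_or_eq_neg.1 hre with h | h
    · -- `w = a`, `g(a) = ρ`
      have hs : Complex.sqrt (w - 2) * Complex.sqrt (w + 2) = ((ρ - ρ⁻¹ : ℝ) : ℂ) := by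
        rw [hw', h, show ((ρ + ρ⁻¹ : ℝ) : ℂ) - 2 = ((ρ + ρ⁻¹ - 2 : ℝ) : ℂ) by push_cast; ring,
          show ((ρ + ρ⁻¹ : ℝ) : ℂ) + 2 = ((ρ + ρ⁻¹ + 2 : ℝ) : ℂ) by push_cast; ring,
          sqrt_ofReal (by linarith), sqrt_ofReal (by linarith), ← Complex.ofReal_mul,
          ← Real.sqrt_mul (by linarith),
          show (ρ + ρ⁻¹ - 2) * (ρ + ρ⁻¹ + 2) = (ρ - ρ⁻¹) ^ 2 by rw [hab]; ring,
          Real.sqrt_sq hb0.le]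
      have hg : joukowskiInv w = (ρ : ℂ) := by
        unfold joukowskiInv; rw [hs, hw', h]; push_cast; ring
      rw [hg, mem_upperArc]
      simp [abs_of_pos hρ0]
    · -- `w = -a`, `g(-a) = -ρ`
      have hs : Complex.sqrt (w - 2) * Complex.sqrt (w + 2) = -((ρ - ρ⁻¹ : ℝ) : ℂ) := by
        rw [hw', h, show ((-(ρ + ρ⁻¹) : ℝ) : ℂ) - 2 = -((ρ + ρ⁻¹ + 2 : ℝ) : ℂ) by push_cast; ring,
          show ((-(ρ + ρ⁻¹) : ℝ) : ℂ) + 2 = -((ρ + ρ⁻¹ - 2 : ℝ) : ℂ) by push_cast; ring,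
          sqrt_neg_ofReal (by linarith), sqrt_neg_ofReal (by linarith),
          show I * ((Real.sqrt (ρ + ρ⁻¹ + 2) : ℝ) : ℂ) * (I * (Real.sqrt (ρ + ρ⁻¹ - 2) : ℝ)) =
            (I * I) * ((Real.sqrt (ρ + ρ⁻¹ + 2) : ℝ) * (Real.sqrt (ρ + ρ⁻¹ - 2) : ℝ)) by ring,
          I_mul_I, ← Complex.ofReal_mul, ← Real.sqrt_mul (by linarith),
          show (ρ + ρ⁻¹ + 2) * (ρ + ρ⁻¹ - 2) = (ρ - ρ⁻¹) ^ 2 by rw [hab]; ring, Real.sqrt_sq hb0.le]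
        ring
      have hg : joukowskiInv w = -(ρ : ℂ) := by
        unfold joukowskiInv; rw [hs, hw', h]; push_cast; ring
      rw [hg, mem_upperArc]
      simp [abs_of_pos hρ0]
  · -- off the real axis: `w = J(z₀)` with `z₀ = ρ (re w / a + i im w / b)`
    obtain ⟨u, hu⟩ : ∃ u : ℝ, w.re = (ρ + ρ⁻¹) * u :=
      ⟨w.re / (ρ + ρ⁻¹), by rw [mul_div_cancel₀ _ ha0.ne']⟩
    obtain ⟨v, hv⟩ : ∃ v : ℝ, w.im = (ρ - ρ⁻¹) * v :=
      ⟨w.im / (ρ - ρ⁻¹), by rw [mul_div_cancel₀ _ hb0.ne']⟩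
    rw [hu, hv, mul_div_cancel_left₀ _ ha0.ne', mul_div_cancel_left₀ _ hb0.ne'] at hell
    have hv0 : 0 < v := (mul_pos_iff_of_pos_left hb0).1 (hv ▸ hpos)
    set z₀ : ℂ := (ρ : ℂ) * ((u : ℂ) + (v : ℂ) * I) with hz₀
    have hz₀im : z₀.im = ρ * v := by simp [hz₀]
    have hz₀re : z₀.re = ρ * u := by simp [hz₀]
    have hnormSq : Complex.normSq z₀ = ρ ^ 2 := by
      rw [Complex.normSq_apply, hz₀re, hz₀im]
      nlinarith [hell]
    have hnorm : ‖z₀‖ = ρ := by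
      have : ‖z₀‖ ^ 2 = ρ ^ 2 := by rw [← Complex.normSq_eq_norm_sq, hnormSq]
      nlinarith [norm_nonneg z₀]
    have hρ2 : ρ ^ 2 ≠ 0 := by positivity
    have hJ : joukowski z₀ = w := by
      apply Complex.ext
      · rw [joukowski, add_re, inv_re, hnormSq, hz₀re, hu]
        rw [div_eq_mul_inv, show ρ * u * (ρ ^ 2)⁻¹ = ρ⁻¹ * u by field_simp]
        ring
      · rw [joukowski, add_im, inv_im, hnormSq, hz₀im, hv]
        rw [div_eq_mul_inv, show -(ρ * v) * (ρ ^ 2)⁻¹ = -(ρ⁻¹ * v) by field_simp]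
        ring
    have hzim : 0 < z₀.im := by rw [hz₀im]; positivity
    have hg : joukowskiInv w = z₀ := by
      rw [← hJ]; exact joukowskiInv_joukowski hzim (by rwa [hJ])
    rw [hg, mem_upperArc]
    exact ⟨hnorm, hzim.le⟩

/-- `g` is holomorphic on the open upper half plane. [folklore] -/
theorem differentiableOn_joukowskiInv : DifferentiableOn ℂ joukowskiInv upperHalfPlaneSet := by
  intro w hw
  have hw' : 0 < w.im := hw
  have h1 : 0 < (w - 2).im := by simpa using hw'
  have h2 : 0 < (w + 2).im := by simpa using hw'
  apply DifferentiableAt.differentiableWithinAt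
  have hd1 : DifferentiableAt ℂ (fun w ↦ Complex.sqrt (w - 2)) w :=
    (differentiableAt_sqrt_of_im_pos h1).comp w (differentiableAt_id.sub_const 2)
  have hd2 : DifferentiableAt ℂ (fun w ↦ Complex.sqrt (w + 2)) w :=
    (differentiableAt_sqrt_of_im_pos h2).comp w (differentiableAt_id.add_const 2)
  exact (differentiableAt_id.add (hd1.mul hd2)).div_const 2

/-- `g` is continuous on the closed upper half plane. [folklore] -/
theorem continuousOn_joukowskiInv : ContinuousOn joukowskiInv {w : ℂ | 0 ≤ w.im} := by
  have h1 : ContinuousOn (fun w ↦ Complex.sqrt (w - 2)) {w : ℂ | 0 ≤ w.im} :=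
    continuousOn_sqrt_im_nonneg.comp (continuousOn_id.sub continuousOn_const)
      fun w hw ↦ by simpa using hw
  have h2 : ContinuousOn (fun w ↦ Complex.sqrt (w + 2)) {w : ℂ | 0 ≤ w.im} :=
    continuousOn_sqrt_im_nonneg.comp (continuousOn_id.add continuousOn_const)
      fun w hw ↦ by simpa using hw
  exact (continuousOn_id.add (h1.mul h2)).div_const 2

/-- **The extremal distance between `[-2, 2]` and the upper half-ellipse with semi-axes
`ρ ± 1/ρ`, with respect to the half-ellipse domain `D(ρ)`, is `log ρ / π`** (conformal invariance
under the Joukowski map, `extremalDistance_halfAnnulus`). [cite: Ahlfors1973CI, §4-2 p. 53] -/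
theorem extremalDistance_halfEllipseDomain {ρ : ℝ} (hρ : 1 < ρ) :
    extremalDistance (halfEllipseDomain ρ) (Icc (-2) 2 ×ℂ {0}) (upperHalfEllipse ρ) =
      ENNReal.ofReal (Real.log ρ / π) := by
  rw [← extremalDistance_halfAnnulus hρ]
  refine le_antisymm ?_ ?_
  · -- `J : H(ρ) → D(ρ)`
    refine extremalDistance_le_of_mapsTo (isOpen_halfAnnulus ρ) (differentiableOn_joukowski ρ)
      (injOn_joukowski ρ) (continuousOn_joukowski ?_) (joukowski_image_halfAnnulus hρ)
      joukowski_mapsTo_segment (joukowski_mapsTo_upperHalfEllipse hρ)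
    rintro ((h | h) | h)
    · simp at h
    · simp only [mem_upperArc, norm_zero] at h; linarith [h.1]
    · simp at h
  · -- `g : D(ρ) → H(ρ)`
    refine extremalDistance_le_of_mapsTo (isOpen_halfEllipseDomain ρ)
      (differentiableOn_joukowskiInv.mono fun w hw ↦ hw.1) injective_joukowskiInv.injOn
      (continuousOn_joukowskiInv.mono ?_) (joukowskiInv_image_halfEllipseDomain hρ)
      joukowskiInv_mapsTo_upperArc_one (joukowskiInv_mapsTo_upperArc hρ)
    rintro w ((h | h) | h)
    · rw [mem_reProdIm, mem_singleton_iff] at h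
      exact h.2.ge
    · exact h.1
    · exact h.1.le

/-! ### The upper half disk between two half-ellipse domains -/

/-- The upper half disk `S(P) = {|w| < P, im w > 0}`. [folklore] -/
def upperHalfDisk (P : ℝ) : Set ℂ := {w | ‖w‖ < P ∧ 0 < w.im}

/-- Membership in the upper half disk. [folklore] -/
@[simp] theorem mem_upperHalfDisk {P : ℝ} {w : ℂ} : w ∈ upperHalfDisk P ↔ ‖w‖ < P ∧ 0 < w.im :=
  Iff.rfl

/-- The upper half disk is open. [folklore] -/
theorem isOpen_upperHalfDisk (P : ℝ) : IsOpen (upperHalfDisk P) :=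
  (isOpen_lt continuous_norm continuous_const).inter (isOpen_lt continuous_const continuous_im)

/-- `|w|² = re² + im²`. [folklore] -/
theorem norm_sq_eq_re_sq_add_im_sq (w : ℂ) : ‖w‖ ^ 2 = w.re ^ 2 + w.im ^ 2 := by
  rw [← Complex.normSq_eq_norm_sq, Complex.normSq_apply]; ring

/-- Inside the ellipse with semi-axes `a ≥ b > 0` one has `|w| < a`. [folklore] -/
theorem norm_lt_of_gauge_lt_one {w : ℂ} {a b : ℝ} (ha : 0 < a) (hb : 0 < b) (hba : b ≤ a)
    (h : (w.re / a) ^ 2 + (w.im / b) ^ 2 < 1) : ‖w‖ < a := by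
  have h0 : (w.im / a) ^ 2 ≤ (w.im / b) ^ 2 := by
    rw [div_pow, div_pow]
    exact div_le_div_of_nonneg_left (sq_nonneg _) (pow_pos hb 2) (by gcongr)
  have h1 : (w.re / a) ^ 2 + (w.im / a) ^ 2 < 1 := by linarith
  have h2 : ‖w‖ ^ 2 < a ^ 2 := by
    rw [norm_sq_eq_re_sq_add_im_sq]
    rw [div_pow, div_pow, ← add_div, div_lt_one (pow_pos ha 2)] at h1
    exact h1
  exact lt_of_pow_lt_pow_left₀ 2 ha.le h2

/-- On or outside the ellipse with semi-axes `a ≥ b > 0` one has `b ≤ |w|`. [folklore] -/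
theorem le_norm_of_one_le_gauge {w : ℂ} {a b : ℝ} (hb : 0 < b) (hba : b ≤ a)
    (h : 1 ≤ (w.re / a) ^ 2 + (w.im / b) ^ 2) : b ≤ ‖w‖ := by
  have h0 : (w.re / a) ^ 2 ≤ (w.re / b) ^ 2 := by
    rw [div_pow, div_pow]
    exact div_le_div_of_nonneg_left (sq_nonneg _) (pow_pos hb 2) (by gcongr)
  have h1 : 1 ≤ (w.re / b) ^ 2 + (w.im / b) ^ 2 := by linarith
  have h2 : b ^ 2 ≤ ‖w‖ ^ 2 := by
    rw [norm_sq_eq_re_sq_add_im_sq]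
    rw [div_pow, div_pow, ← add_div, one_le_div (pow_pos hb 2)] at h1
    exact h1
  exact le_of_pow_le_pow_left₀ two_ne_zero (norm_nonneg w) h2

/-- Inside the disk of radius `b ≤ a` one is inside the ellipse with semi-axes `a, b`. [folklore] -/
theorem gauge_lt_one_of_norm_lt {w : ℂ} {a b : ℝ} (hb : 0 < b) (hba : b ≤ a)
    (h : ‖w‖ < b) : (w.re / a) ^ 2 + (w.im / b) ^ 2 < 1 := by
  have h0 : (w.re / a) ^ 2 ≤ (w.re / b) ^ 2 := by
    rw [div_pow, div_pow]
    exact div_le_div_of_nonneg_left (sq_nonneg _) (pow_pos hb 2) (by gcongr)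
  have h1 : (w.re / b) ^ 2 + (w.im / b) ^ 2 < 1 := by
    rw [div_pow, div_pow, ← add_div, div_lt_one (pow_pos hb 2), ← norm_sq_eq_re_sq_add_im_sq]
    exact pow_lt_pow_left₀ h (norm_nonneg w) two_ne_zero
  linarith

/-- On the circle of radius `a ≥ b` one is on or outside the ellipse with semi-axes `a, b`.
[folklore] -/
theorem one_le_gauge_of_norm_eq {w : ℂ} {a b : ℝ} (ha : 0 < a) (hb : 0 < b) (hba : b ≤ a)
    (h : ‖w‖ = a) : 1 ≤ (w.re / a) ^ 2 + (w.im / b) ^ 2 := by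
  have h0 : (w.im / a) ^ 2 ≤ (w.im / b) ^ 2 := by
    rw [div_pow, div_pow]
    exact div_le_div_of_nonneg_left (sq_nonneg _) (pow_pos hb 2) (by gcongr)
  have h1 : (w.re / a) ^ 2 + (w.im / a) ^ 2 = 1 := by
    rw [div_pow, div_pow, ← add_div, ← norm_sq_eq_re_sq_add_im_sq, h, div_self (pow_pos ha 2).ne']
  linarith

/-- For `P > 2` the number `ρ⁻ = (P + √(P² - 4))/2` satisfies `ρ⁻ > 1` and `ρ⁻ + 1/ρ⁻ = P`.
[folklore] -/
theorem rhoMinus_spec {P : ℝ} (hP : 2 < P) :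
    1 < (P + Real.sqrt (P ^ 2 - 4)) / 2 ∧
      (P + Real.sqrt (P ^ 2 - 4)) / 2 + ((P + Real.sqrt (P ^ 2 - 4)) / 2)⁻¹ = P := by
  have h4 : 0 ≤ P ^ 2 - 4 := by nlinarith
  have hs := Real.sqrt_nonneg (P ^ 2 - 4)
  have hinv : ((P + Real.sqrt (P ^ 2 - 4)) / 2)⁻¹ = (P - Real.sqrt (P ^ 2 - 4)) / 2 := by
    refine inv_eq_of_mul_eq_one_right ?_
    have := Real.sq_sqrt h4
    nlinarith
  refine ⟨by linarith, ?_⟩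
  rw [hinv]
  ring

/-- For `P > 0` the number `ρ⁺ = (P + √(P² + 4))/2` satisfies `ρ⁺ > 1` and `ρ⁺ - 1/ρ⁺ = P`.
[folklore] -/
theorem rhoPlus_spec {P : ℝ} (hP : 0 < P) :
    1 < (P + Real.sqrt (P ^ 2 + 4)) / 2 ∧
      (P + Real.sqrt (P ^ 2 + 4)) / 2 - ((P + Real.sqrt (P ^ 2 + 4)) / 2)⁻¹ = P := by
  have h4 : 0 ≤ P ^ 2 + 4 := by positivity
  have hs2 : 2 ≤ Real.sqrt (P ^ 2 + 4) := by
    rw [show (2 : ℝ) = Real.sqrt (2 ^ 2) by rw [Real.sqrt_sq zero_le_two]]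
    exact Real.sqrt_le_sqrt (by nlinarith)
  have hinv : ((P + Real.sqrt (P ^ 2 + 4)) / 2)⁻¹ = (Real.sqrt (P ^ 2 + 4) - P) / 2 := by
    refine inv_eq_of_mul_eq_one_right ?_
    have := Real.sq_sqrt h4
    nlinarith
  refine ⟨by linarith, ?_⟩
  rw [hinv]
  ring

/-- **Lower bound for the half disk**: for `P > 2` and `ρ⁻ + 1/ρ⁻ = P`,
`log ρ⁻ / π ≤ d_{S(P)}([-2, 2], upper half circle)`. Every path from `[-2, 2]` to the half circle
of radius `P = ρ⁻ + 1/ρ⁻` (the major semi-axis) within `S(P)` first exits the half-ellipse domain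
`D(ρ⁻) ⊆ S(P)` through the half-ellipse (comparison principle). [folklore] -/
theorem le_extremalDistance_upperHalfDisk {P : ℝ} (hP : 2 < P) :
    ENNReal.ofReal (Real.log ((P + Real.sqrt (P ^ 2 - 4)) / 2) / π) ≤
      extremalDistance (upperHalfDisk P) (Icc (-2) 2 ×ℂ {0}) (upperArc P) := by
  obtain ⟨hρ, hρP⟩ := rhoMinus_spec hP
  set ρ := (P + Real.sqrt (P ^ 2 - 4)) / 2 with hρdef
  have hρ0 : 0 < ρ := one_pos.trans hρ
  have ha0 : 0 < ρ + ρ⁻¹ := by positivity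
  have hb0 : 0 < ρ - ρ⁻¹ := sub_inv_pos hρ
  have hba : ρ - ρ⁻¹ ≤ ρ + ρ⁻¹ := by linarith [inv_pos.2 hρ0]
  rw [← extremalDistance_halfEllipseDomain hρ, ← hρP]
  set U : Set ℂ := {w | (w.re / (ρ + ρ⁻¹)) ^ 2 + (w.im / (ρ - ρ⁻¹)) ^ 2 < 1} with hU
  have hcont : Continuous fun w : ℂ ↦ (w.re / (ρ + ρ⁻¹)) ^ 2 + (w.im / (ρ - ρ⁻¹)) ^ 2 := by
    fun_prop
  have hUo : IsOpen U := isOpen_lt hcont continuous_const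
  have hΩU : upperHalfDisk (ρ + ρ⁻¹) ∩ U = halfEllipseDomain ρ := by
    ext w
    simp only [mem_inter_iff, mem_upperHalfDisk, hU, mem_setOf_eq, mem_halfEllipseDomain]
    constructor
    · rintro ⟨⟨-, him⟩, hg⟩; exact ⟨him, hg⟩
    · rintro ⟨him, hg⟩; exact ⟨⟨norm_lt_of_gauge_lt_one ha0 hb0 hba hg, him⟩, hg⟩
  rw [← hΩU]
  refine extremalDistance_inter_le (isOpen_upperHalfDisk _) hUo ?_ ?_ ?_
  · -- `[-2, 2] ⊆ U`
    intro w hw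
    rw [mem_reProdIm, mem_singleton_iff] at hw
    have h2 := two_lt_add_inv hρ
    have hre : |w.re| < ρ + ρ⁻¹ := (abs_le.2 hw.1).trans_lt h2
    simp only [hU, mem_setOf_eq, hw.2, zero_div, ne_eq, OfNat.ofNat_ne_zero, not_false_eq_true,
      zero_pow, add_zero]
    rw [div_pow, div_lt_one (pow_pos ha0 2)]
    exact sq_lt_sq' (abs_lt.1 hre).1 (abs_lt.1 hre).2
  · -- the half circle avoids `U`
    refine Set.disjoint_left.2 fun w hw hwU ↦ ?_
    exact (one_le_gauge_of_norm_eq ha0 hb0 hba hw.1).not_gt hwU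
  · -- frontier points of `U` in the closed upper half plane lie on the upper half-ellipse
    rintro w ⟨hfr, hmem⟩
    refine ⟨?_, frontier_lt_subset_eq hcont continuous_const hfr⟩
    rcases hmem with h | h
    · exact h.2.le
    · exact h.2

/-- **Upper bound for the half disk**: for `P > 2` and `ρ⁺ - 1/ρ⁺ = P`,
`d_{S(P)}([-2, 2], upper half circle minus `-P`) ≤ log ρ⁺ / π`. Every path from `[-2, 2]` to
the upper half-ellipse within `D(ρ⁺) ⊇ S(P)` (`P` is the minor semi-axis) first exits the half
disk through the half circle, at a point other than `± P` (comparison principle). [folklore] -/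
theorem extremalDistance_upperHalfDisk_le {P : ℝ} (hP : 2 < P) :
    extremalDistance (upperHalfDisk P) (Icc (-2) 2 ×ℂ {0}) (upperArc P \ {-(P : ℂ)}) ≤
      ENNReal.ofReal (Real.log ((P + Real.sqrt (P ^ 2 + 4)) / 2) / π) := by
  have hP0 : 0 < P := by linarith
  obtain ⟨hρ, hρP⟩ := rhoPlus_spec hP0
  set ρ := (P + Real.sqrt (P ^ 2 + 4)) / 2 with hρdef
  have hρ0 : 0 < ρ := one_pos.trans hρ
  have ha0 : 0 < ρ + ρ⁻¹ := by positivity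
  have hb0 : 0 < ρ - ρ⁻¹ := sub_inv_pos hρ
  have hba : ρ - ρ⁻¹ ≤ ρ + ρ⁻¹ := by linarith [inv_pos.2 hρ0]
  rw [← extremalDistance_halfEllipseDomain hρ, ← hρP]
  have hΩU : halfEllipseDomain ρ ∩ ball 0 (ρ - ρ⁻¹) = upperHalfDisk (ρ - ρ⁻¹) := by
    ext w
    simp only [mem_inter_iff, mem_halfEllipseDomain, mem_ball_zero_iff, mem_upperHalfDisk]
    constructor
    · rintro ⟨⟨him, -⟩, hn⟩; exact ⟨hn, him⟩
    · rintro ⟨hn, him⟩; exact ⟨⟨him, gauge_lt_one_of_norm_lt hb0 hba hn⟩, hn⟩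
  rw [← hΩU]
  refine extremalDistance_inter_le (isOpen_halfEllipseDomain ρ) isOpen_ball ?_ ?_ ?_
  · -- `[-2, 2] ⊆ ball 0 P`
    intro w hw
    rw [mem_reProdIm, mem_singleton_iff] at hw
    rw [mem_ball_zero_iff, ← Complex.re_add_im w, hw.2]
    simp only [ofReal_zero, zero_mul, add_zero, norm_real, Real.norm_eq_abs]
    rw [hρP]
    exact (abs_le.2 hw.1).trans_lt hP
  · -- the half-ellipse avoids the ball
    refine Set.disjoint_left.2 fun w hw hwU ↦ ?_
    rw [mem_ball_zero_iff] at hwU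
    exact (le_norm_of_one_le_gauge hb0 hba hw.2.ge).not_gt hwU
  · -- frontier points of the ball in `D(ρ) ∪ half-ellipse` lie on the half circle, are not `-P`
    rintro w ⟨hfr, hmem⟩
    have hn : ‖w‖ = ρ - ρ⁻¹ := by simpa using frontier_ball_subset_sphere hfr
    refine ⟨⟨hn, ?_⟩, ?_⟩
    · rcases hmem with h | h
      · exact h.1.le
      · exact h.1
    · rw [mem_singleton_iff]
      rintro rfl
      rcases hmem with h | h
      · simp at h
      · have h1 := h.2
        simp only [neg_re, ofReal_re, neg_im, ofReal_im, neg_zero, zero_div, ne_eq,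
          OfNat.ofNat_ne_zero, not_false_eq_true, zero_pow, add_zero] at h1
        rw [div_pow, div_eq_one_iff_eq (pow_pos ha0 2).ne'] at h1
        nlinarith [inv_pos.2 hρ0]

/-! ### The half plane and the half disk -/

/-- The elementary conformal map `F_P(w) = -((P - w)/(P + w))²` of the upper half disk `S(P)`
onto the upper half plane (half disk → quadrant → half plane, normalised so that the vertex `-P`
goes to `∞` and `P` to `0`). [folklore] -/
def halfDiskToHalfPlane (P : ℝ) (w : ℂ) : ℂ := -(((P : ℂ) - w) / ((P : ℂ) + w)) ^ 2

/-- Its inverse `f_P(ζ) = P (1 + i √ζ)/(1 - i √ζ)` (principal square root). [folklore] -/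
def halfPlaneToHalfDisk (P : ℝ) (ζ : ℂ) : ℂ :=
  (P : ℂ) * (1 + I * Complex.sqrt ζ) / (1 - I * Complex.sqrt ζ)

section HalfDiskMap

variable {P : ℝ} {w ζ : ℂ}

/-- Real and imaginary parts of the Möbius map `u = (P - w)/(P + w)`. [folklore] -/
theorem moebius_re_im (P : ℝ) (w : ℂ) :
    (((P : ℂ) - w) / ((P : ℂ) + w)).re = (P ^ 2 - ‖w‖ ^ 2) / Complex.normSq ((P : ℂ) + w) ∧
    (((P : ℂ) - w) / ((P : ℂ) + w)).im = -(2 * P * w.im) / Complex.normSq ((P : ℂ) + w) := by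
  rw [Complex.div_re, Complex.div_im, norm_sq_eq_re_sq_add_im_sq]
  simp only [sub_re, ofReal_re, add_re, sub_im, ofReal_im, zero_sub, add_im, zero_add]
  constructor
  · rw [← add_div]; ring
  · rw [← sub_div]; ring

/-- `P + w ≠ 0` for `w` in the open upper half plane. [folklore] -/
theorem ofReal_add_ne_zero_of_im_pos (P : ℝ) (hw : 0 < w.im) : (P : ℂ) + w ≠ 0 := by
  intro h
  have := congrArg Complex.im h
  simp at this
  linarith

/-- On the upper half disk the Möbius map `u = (P - w)/(P + w)` has positive real part and
negative imaginary part. [folklore] -/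
theorem moebius_re_pos_im_neg (hP : 0 < P) (hw : w ∈ upperHalfDisk P) :
    0 < (((P : ℂ) - w) / ((P : ℂ) + w)).re ∧ (((P : ℂ) - w) / ((P : ℂ) + w)).im < 0 := by
  have hN : 0 < Complex.normSq ((P : ℂ) + w) :=
    Complex.normSq_pos.2 (ofReal_add_ne_zero_of_im_pos P hw.2)
  obtain ⟨hre, him⟩ := moebius_re_im P w
  rw [hre, him]
  refine ⟨div_pos ?_ hN, ?_⟩
  · have := hw.1
    have h0 := norm_nonneg w
    nlinarith
  · rw [neg_div]
    exact neg_neg_of_pos (div_pos (by nlinarith [hw.2]) hN)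

/-- Imaginary part of `F_P(w) = -u²`: `im F = -2 re u · im u`. [folklore] -/
theorem halfDiskToHalfPlane_im (P : ℝ) (w : ℂ) :
    (halfDiskToHalfPlane P w).im =
      -(2 * (((P : ℂ) - w) / ((P : ℂ) + w)).re * (((P : ℂ) - w) / ((P : ℂ) + w)).im) := by
  rw [halfDiskToHalfPlane, neg_im, sq, mul_im]; ring

/-- `F_P` maps the upper half disk into the upper half plane. [folklore] -/
theorem halfDiskToHalfPlane_mapsTo (hP : 0 < P) :
    MapsTo (halfDiskToHalfPlane P) (upperHalfDisk P) upperHalfPlaneSet := by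
  intro w hw
  obtain ⟨hre, him⟩ := moebius_re_pos_im_neg hP hw
  show 0 < (halfDiskToHalfPlane P w).im
  rw [halfDiskToHalfPlane_im]
  nlinarith [mul_neg_of_pos_of_neg hre him]

/-- Two complex numbers with the same square and positive real parts are equal. [folklore] -/
theorem eq_of_sq_eq_sq_of_re_pos {u v : ℂ} (h : u ^ 2 = v ^ 2) (hu : 0 < u.re) (hv : 0 < v.re) :
    u = v := by
  rcases sq_eq_sq_iff_eq_or_eq_neg.1 h with h' | h'
  · exact h'
  · rw [h', Complex.neg_re] at hu
    linarith

/-- The Möbius map `u = (P - w)/(P + w)` is inverted by `w = P (1 - u)/(1 + u)`. [folklore] -/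
theorem eq_of_moebius_eq (hP : P ≠ 0) (hw : (P : ℂ) + w ≠ 0) {u : ℂ}
    (hu : ((P : ℂ) - w) / ((P : ℂ) + w) = u) : w = (P : ℂ) * (1 - u) / (1 + u) := by
  have h1 : (1 : ℂ) + u ≠ 0 := by
    intro h0
    have key : ((1 : ℂ) + u) * ((P : ℂ) + w) = 2 * P := by
      rw [← hu, add_mul, one_mul, div_mul_cancel₀ _ hw]; ring
    rw [h0, zero_mul] at key
    exact mul_ne_zero two_ne_zero (Complex.ofReal_ne_zero.2 hP) key.symm
  rw [eq_div_iff h1, ← hu]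
  field_simp
  ring

/-- `F_P` is injective on the upper half disk. [folklore] -/
theorem injOn_halfDiskToHalfPlane (hP : 0 < P) : InjOn (halfDiskToHalfPlane P) (upperHalfDisk P) := by
  intro w₁ hw₁ w₂ hw₂ h
  have hu : ((P : ℂ) - w₁) / ((P : ℂ) + w₁) = ((P : ℂ) - w₂) / ((P : ℂ) + w₂) :=
    eq_of_sq_eq_sq_of_re_pos (neg_injective h) (moebius_re_pos_im_neg hP hw₁).1
      (moebius_re_pos_im_neg hP hw₂).1
  calc w₁ = (P : ℂ) * (1 - ((P : ℂ) - w₂) / ((P : ℂ) + w₂)) / (1 + ((P : ℂ) - w₂) / ((P : ℂ) + w₂)) :=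
        eq_of_moebius_eq hP.ne' (ofReal_add_ne_zero_of_im_pos P hw₁.2) hu
    _ = w₂ := (eq_of_moebius_eq hP.ne' (ofReal_add_ne_zero_of_im_pos P hw₂.2) rfl).symm

/-- `F_P` is holomorphic on the upper half disk. [folklore] -/
theorem differentiableOn_halfDiskToHalfPlane (P : ℝ) :
    DifferentiableOn ℂ (halfDiskToHalfPlane P) (upperHalfDisk P) := by
  intro w hw
  apply DifferentiableAt.differentiableWithinAt
  unfold halfDiskToHalfPlane
  exact (((differentiableAt_const _).sub differentiableAt_id).div
    ((differentiableAt_const _).add differentiableAt_id)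
    (ofReal_add_ne_zero_of_im_pos P hw.2)).pow 2 |>.neg

/-- `F_P` is continuous away from its pole `-P`. [folklore] -/
theorem continuousOn_halfDiskToHalfPlane {S : Set ℂ} (hS : ∀ w ∈ S, (P : ℂ) + w ≠ 0) :
    ContinuousOn (halfDiskToHalfPlane P) S := by
  intro w hw
  apply ContinuousAt.continuousWithinAt
  unfold halfDiskToHalfPlane
  exact (((continuousAt_const.sub continuousAt_id).div (continuousAt_const.add continuousAt_id)
    (hS w hw)).pow 2).neg

/-- `F_P` maps `[-2, 2]` into `[-μ², -μ⁻²]`, `μ = (P + 2)/(P - 2)` (`P > 2`). [folklore] -/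
theorem halfDiskToHalfPlane_mapsTo_segment (hP : 2 < P) :
    MapsTo (halfDiskToHalfPlane P) (Icc (-2) 2 ×ℂ {0})
      (Icc (-((P + 2) / (P - 2)) ^ 2) (-((P - 2) / (P + 2)) ^ 2) ×ℂ {0}) := by
  intro w hw
  rw [mem_reProdIm, mem_singleton_iff] at hw
  obtain ⟨⟨hx1, hx2⟩, him⟩ := hw
  have hw' : w = (w.re : ℂ) := by apply Complex.ext <;> simp [him]
  set x := w.re with hx
  have hpx : 0 < P + x := by linarith
  have hu : ((P : ℂ) - w) / ((P : ℂ) + w) = (((P - x) / (P + x) : ℝ) : ℂ) := by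
    rw [hw', Complex.ofReal_div, Complex.ofReal_sub, Complex.ofReal_add]
  have hF : halfDiskToHalfPlane P w = ((-((P - x) / (P + x)) ^ 2 : ℝ) : ℂ) := by
    rw [halfDiskToHalfPlane, hu, Complex.ofReal_neg, Complex.ofReal_pow]
  rw [hF, mem_reProdIm, ofReal_re, ofReal_im, mem_singleton_iff]
  refine ⟨⟨?_, ?_⟩, rfl⟩
  · -- `u ≤ μ`
    have h1 : (P - x) / (P + x) ≤ (P + 2) / (P - 2) := by
      rw [div_le_div_iff₀ hpx (by linarith)]
      nlinarith
    have h0 : 0 ≤ (P - x) / (P + x) := div_nonneg (by linarith) hpx.le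
    nlinarith [mul_le_mul h1 h1 h0 (h0.trans h1)]
  · -- `μ⁻¹ ≤ u`
    have h1 : (P - 2) / (P + 2) ≤ (P - x) / (P + x) := by
      rw [div_le_div_iff₀ (by linarith) hpx]
      nlinarith
    have h0 : 0 ≤ (P - 2) / (P + 2) := div_nonneg (by linarith) (by linarith)
    nlinarith [mul_le_mul h1 h1 h0 (h0.trans h1)]

/-- `F_P` maps the upper half circle minus `-P` into `[0, +∞)`. [folklore] -/
theorem halfDiskToHalfPlane_mapsTo_arc (P : ℝ) :
    MapsTo (halfDiskToHalfPlane P) (upperArc P \ {-(P : ℂ)}) (Ici 0 ×ℂ {0}) := by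
  rintro w ⟨⟨hn, him⟩, hne⟩
  rw [mem_singleton_iff] at hne
  have hPw : (P : ℂ) + w ≠ 0 := fun h ↦ hne (by linear_combination h)
  obtain ⟨hre, him'⟩ := moebius_re_im P w
  have hre0 : (((P : ℂ) - w) / ((P : ℂ) + w)).re = 0 := by rw [hre, hn]; ring
  set u := ((P : ℂ) - w) / ((P : ℂ) + w) with hu
  obtain ⟨t, ht⟩ : ∃ t : ℝ, u = (t : ℂ) * I := ⟨u.im, by apply Complex.ext <;> simp [hre0]⟩
  have hF : halfDiskToHalfPlane P w = ((t ^ 2 : ℝ) : ℂ) := by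
    rw [halfDiskToHalfPlane, ← hu, ht, mul_pow, I_sq, Complex.ofReal_pow]
    ring
  rw [hF, mem_reProdIm, ofReal_re, ofReal_im, mem_singleton_iff]
  exact ⟨mem_Ici.2 (sq_nonneg _), rfl⟩

/-- `1 - i √ζ ≠ 0` on the closed upper half plane (indeed everywhere: `re √ζ ≥ 0`). [folklore] -/
theorem one_sub_I_mul_sqrt_ne_zero (ζ : ℂ) : 1 - I * Complex.sqrt ζ ≠ 0 := by
  intro h
  have := congrArg Complex.re h
  simp only [sub_re, one_re, mul_re, I_re, zero_mul, I_im, one_mul, zero_sub, sub_neg_eq_add,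
    zero_re] at this
  by_cases hζ : 0 ≤ ζ.im
  · linarith [sqrt_im_nonneg hζ]
  · -- `im √ζ < 0` is possible only off the closed upper half plane; there `re √ζ > 0`
    have hre := congrArg Complex.im h
    simp only [sub_im, one_im, mul_im, I_re, zero_mul, I_im, one_mul, zero_add, zero_sub,
      zero_im, neg_eq_zero] at hre
    -- `re √ζ = 0` and `im √ζ = -1` give `ζ = (√ζ)² = -1`, whose imaginary part is `0 ≥ 0`
    have hsq := sqrt_sq ζ
    have hs : Complex.sqrt ζ = -I := by
      apply Complex.ext
      · simp [hre]
      · simp only [neg_im, I_im]; linarith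
    rw [hs] at hsq
    apply hζ
    rw [← hsq]
    simp

/-- The value of the Möbius map at `f_P(ζ)`: `(P - f)/(P + f) = -i √ζ`. [folklore] -/
theorem moebius_halfPlaneToHalfDisk (hP : P ≠ 0) (ζ : ℂ) :
    ((P : ℂ) - halfPlaneToHalfDisk P ζ) / ((P : ℂ) + halfPlaneToHalfDisk P ζ) =
      -I * Complex.sqrt ζ := by
  have hd := one_sub_I_mul_sqrt_ne_zero ζ
  have hP' : (P : ℂ) ≠ 0 := Complex.ofReal_ne_zero.2 hP
  have h1 : (P : ℂ) - halfPlaneToHalfDisk P ζ =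
      (P : ℂ) * (-2 * I * Complex.sqrt ζ) / (1 - I * Complex.sqrt ζ) := by
    rw [halfPlaneToHalfDisk, eq_div_iff hd, sub_mul, div_mul_cancel₀ _ hd]; ring
  have h2 : (P : ℂ) + halfPlaneToHalfDisk P ζ = 2 * (P : ℂ) / (1 - I * Complex.sqrt ζ) := by
    rw [halfPlaneToHalfDisk, eq_div_iff hd, add_mul, div_mul_cancel₀ _ hd]; ring
  rw [h1, h2, div_div_div_cancel_right₀ hd, div_eq_iff (mul_ne_zero two_ne_zero hP')]
  ring

/-- **`F_P (f_P ζ) = ζ`** for every `ζ`. [folklore] -/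
theorem halfDiskToHalfPlane_halfPlaneToHalfDisk (hP : P ≠ 0) (ζ : ℂ) :
    halfDiskToHalfPlane P (halfPlaneToHalfDisk P ζ) = ζ := by
  rw [halfDiskToHalfPlane, moebius_halfPlaneToHalfDisk hP, mul_pow, neg_sq, I_sq, sqrt_sq]
  ring

/-- Norm and imaginary part of `f_P(ζ)` in terms of `v = √ζ`. [folklore] -/
theorem halfPlaneToHalfDisk_normSq_im (P : ℝ) (ζ : ℂ) :
    Complex.normSq (1 + I * Complex.sqrt ζ) =
        (1 - (Complex.sqrt ζ).im) ^ 2 + (Complex.sqrt ζ).re ^ 2 ∧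
      Complex.normSq (1 - I * Complex.sqrt ζ) =
        (1 + (Complex.sqrt ζ).im) ^ 2 + (Complex.sqrt ζ).re ^ 2 ∧
      (halfPlaneToHalfDisk P ζ).im =
        P * (2 * (Complex.sqrt ζ).re) / Complex.normSq (1 - I * Complex.sqrt ζ) := by
  set v := Complex.sqrt ζ with hv
  have h1 : Complex.normSq (1 + I * v) = (1 - v.im) ^ 2 + v.re ^ 2 := by
    rw [Complex.normSq_apply]; simp; ring
  have h2 : Complex.normSq (1 - I * v) = (1 + v.im) ^ 2 + v.re ^ 2 := by
    rw [Complex.normSq_apply]; simp; ring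
  refine ⟨h1, h2, ?_⟩
  rw [halfPlaneToHalfDisk, ← hv, mul_div_assoc, im_ofReal_mul, Complex.div_im]
  simp only [add_im, one_im, mul_im, I_re, zero_mul, I_im, one_mul, zero_add, sub_re, one_re,
    mul_re, zero_sub, sub_neg_eq_add, add_re, sub_im]
  rw [← sub_div]
  ring

/-- `f_P` maps the upper half plane into the upper half disk. [folklore] -/
theorem halfPlaneToHalfDisk_mapsTo (hP : 0 < P) :
    MapsTo (halfPlaneToHalfDisk P) upperHalfPlaneSet (upperHalfDisk P) := by
  intro ζ hζ
  have hζ' : 0 < ζ.im := hζ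
  obtain ⟨h1, h2, h3⟩ := halfPlaneToHalfDisk_normSq_im P ζ
  have hre := sqrt_re_pos hζ'
  have him := sqrt_im_pos hζ'
  have hd := one_sub_I_mul_sqrt_ne_zero ζ
  have hN : 0 < Complex.normSq (1 - I * Complex.sqrt ζ) := Complex.normSq_pos.2 hd
  refine ⟨?_, ?_⟩
  · rw [halfPlaneToHalfDisk, norm_div, norm_mul, Complex.norm_real, Real.norm_of_nonneg hP.le,
      mul_div_assoc]
    refine mul_lt_of_lt_one_right hP ?_
    rw [div_lt_one (norm_pos_iff.2 hd)]
    have key : ‖1 + I * Complex.sqrt ζ‖ ^ 2 < ‖1 - I * Complex.sqrt ζ‖ ^ 2 := by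
      rw [← Complex.normSq_eq_norm_sq, ← Complex.normSq_eq_norm_sq, h1, h2]
      nlinarith
    exact lt_of_pow_lt_pow_left₀ 2 (norm_nonneg _) key
  · rw [h3]
    positivity

/-- **`f_P (F_P w) = w`** on the upper half disk. [folklore] -/
theorem halfPlaneToHalfDisk_halfDiskToHalfPlane (hP : 0 < P) (hw : w ∈ upperHalfDisk P) :
    halfPlaneToHalfDisk P (halfDiskToHalfPlane P w) = w := by
  set u := ((P : ℂ) - w) / ((P : ℂ) + w) with hu
  obtain ⟨hre, him⟩ := moebius_re_pos_im_neg hP hw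
  have hsqrt : Complex.sqrt (halfDiskToHalfPlane P w) = I * u := by
    refine sqrt_eq_of_sq_eq (halfDiskToHalfPlane_mapsTo hP hw) (by simpa using hre) ?_
    rw [halfDiskToHalfPlane, ← hu, mul_pow, I_sq]; ring
  have hPw := ofReal_add_ne_zero_of_im_pos P hw.2
  have h1u : (1 : ℂ) + u ≠ 0 := by
    intro h
    have := congrArg Complex.re h
    simp at this
    linarith
  rw [halfPlaneToHalfDisk, hsqrt, ← mul_assoc, I_mul_I, neg_one_mul, sub_neg_eq_add,
    ← sub_eq_add_neg]
  exact (eq_of_moebius_eq hP.ne' hPw hu.symm).symm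

/-- **`F_P` maps the upper half disk onto the upper half plane.** [folklore] -/
theorem halfDiskToHalfPlane_image (hP : 0 < P) :
    halfDiskToHalfPlane P '' upperHalfDisk P = upperHalfPlaneSet := by
  refine (halfDiskToHalfPlane_mapsTo hP).image_subset.antisymm fun ζ hζ ↦ ?_
  exact ⟨halfPlaneToHalfDisk P ζ, halfPlaneToHalfDisk_mapsTo hP hζ,
    halfDiskToHalfPlane_halfPlaneToHalfDisk hP.ne' ζ⟩

/-- **`f_P` maps the upper half plane onto the upper half disk.** [folklore] -/
theorem halfPlaneToHalfDisk_image (hP : 0 < P) :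
    halfPlaneToHalfDisk P '' upperHalfPlaneSet = upperHalfDisk P := by
  refine (halfPlaneToHalfDisk_mapsTo hP).image_subset.antisymm fun w hw ↦ ?_
  exact ⟨halfDiskToHalfPlane P w, halfDiskToHalfPlane_mapsTo hP hw,
    halfPlaneToHalfDisk_halfDiskToHalfPlane hP hw⟩

/-- `f_P` is injective (left inverse `F_P`). [folklore] -/
theorem injective_halfPlaneToHalfDisk (hP : P ≠ 0) : Function.Injective (halfPlaneToHalfDisk P) :=
  Function.LeftInverse.injective (g := halfDiskToHalfPlane P)
    (halfDiskToHalfPlane_halfPlaneToHalfDisk hP)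

/-- `f_P` is holomorphic on the open upper half plane. [folklore] -/
theorem differentiableOn_halfPlaneToHalfDisk (P : ℝ) :
    DifferentiableOn ℂ (halfPlaneToHalfDisk P) upperHalfPlaneSet := by
  intro ζ hζ
  apply DifferentiableAt.differentiableWithinAt
  have hs := differentiableAt_sqrt_of_im_pos (show 0 < ζ.im from hζ)
  unfold halfPlaneToHalfDisk
  exact ((differentiableAt_const _).mul ((differentiableAt_const _).add
    ((differentiableAt_const _).mul hs))).div
    ((differentiableAt_const _).sub ((differentiableAt_const _).mul hs))
    (one_sub_I_mul_sqrt_ne_zero ζ)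

/-- `f_P` is continuous on the closed upper half plane. [folklore] -/
theorem continuousOn_halfPlaneToHalfDisk (P : ℝ) :
    ContinuousOn (halfPlaneToHalfDisk P) {ζ : ℂ | 0 ≤ ζ.im} := by
  have hs := continuousOn_sqrt_im_nonneg
  unfold halfPlaneToHalfDisk
  exact (continuousOn_const.mul (continuousOn_const.add (continuousOn_const.mul hs))).div
    (continuousOn_const.sub (continuousOn_const.mul hs)) fun ζ _ ↦ one_sub_I_mul_sqrt_ne_zero ζ

/-- `f_P` maps `[-μ², -μ⁻²]` into `[-2, 2]` (`μ = (P + 2)/(P - 2)`, `P > 2`):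
`f_P(-x) = P (1 - √x)/(1 + √x)`. [folklore] -/
theorem halfPlaneToHalfDisk_mapsTo_segment (hP : 2 < P) :
    MapsTo (halfPlaneToHalfDisk P)
      (Icc (-((P + 2) / (P - 2)) ^ 2) (-((P - 2) / (P + 2)) ^ 2) ×ℂ {0}) (Icc (-2) 2 ×ℂ {0}) := by
  intro ζ hζ
  rw [mem_reProdIm, mem_singleton_iff] at hζ
  obtain ⟨⟨hx1, hx2⟩, him⟩ := hζ
  have hμ0 : 0 < (P + 2) / (P - 2) := div_pos (by linarith) (by linarith)
  have hμ0' : 0 < (P - 2) / (P + 2) := div_pos (by linarith) (by linarith)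
  set x := -ζ.re with hx
  have hx0 : 0 ≤ x := by rw [hx]; nlinarith
  have hζ' : ζ = -(x : ℂ) := by
    apply Complex.ext <;> simp [hx, him]
  set y := Real.sqrt x with hy
  have hy0 : 0 ≤ y := Real.sqrt_nonneg x
  have hy1 : (P - 2) / (P + 2) ≤ y := by
    rw [hy, ← Real.sqrt_sq hμ0'.le]
    exact Real.sqrt_le_sqrt (by rw [hx]; linarith)
  have hy2 : y ≤ (P + 2) / (P - 2) := by
    rw [hy, ← Real.sqrt_sq hμ0.le]
    exact Real.sqrt_le_sqrt (by rw [hx]; linarith)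
  have hf : halfPlaneToHalfDisk P ζ = ((P * (1 - y) / (1 + y) : ℝ) : ℂ) := by
    rw [halfPlaneToHalfDisk, hζ', sqrt_neg_ofReal hx0, ← hy, ← mul_assoc, I_mul_I, neg_one_mul,
      sub_neg_eq_add, ← sub_eq_add_neg, Complex.ofReal_div, Complex.ofReal_mul, Complex.ofReal_sub,
      Complex.ofReal_add, Complex.ofReal_one]
  rw [hf, mem_reProdIm, ofReal_re, ofReal_im, mem_singleton_iff]
  have h1y : 0 < 1 + y := by linarith
  have hy1' : P - 2 ≤ y * (P + 2) := (div_le_iff₀ (by linarith)).1 hy1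
  have hy2' : y * (P - 2) ≤ P + 2 := (le_div_iff₀ (by linarith)).1 hy2
  refine ⟨⟨?_, ?_⟩, rfl⟩
  · rw [le_div_iff₀ h1y]
    nlinarith
  · rw [div_le_iff₀ h1y]
    nlinarith

/-- `f_P` maps `[0, +∞)` into the upper half circle of radius `P`:
`f_P(x) = P (1 + i √x)/(1 - i √x)`. [folklore] -/
theorem halfPlaneToHalfDisk_mapsTo_arc (hP : 0 < P) :
    MapsTo (halfPlaneToHalfDisk P) (Ici 0 ×ℂ {0}) (upperArc P) := by
  intro ζ hζ
  rw [mem_reProdIm, mem_singleton_iff] at hζ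
  obtain ⟨hx0, him⟩ := hζ
  have hζ' : ζ = (ζ.re : ℂ) := by apply Complex.ext <;> simp [him]
  have hv : Complex.sqrt ζ = (Real.sqrt ζ.re : ℂ) := by rw [hζ', sqrt_ofReal hx0, ofReal_re]
  obtain ⟨h1, h2, h3⟩ := halfPlaneToHalfDisk_normSq_im P ζ
  rw [hv, ofReal_im, ofReal_re] at h1 h2
  rw [hv, ofReal_re] at h3
  refine ⟨?_, ?_⟩
  · rw [halfPlaneToHalfDisk, norm_div, norm_mul, Complex.norm_real, Real.norm_of_nonneg hP.le,
      mul_div_assoc]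
    have : ‖1 + I * Complex.sqrt ζ‖ = ‖1 - I * Complex.sqrt ζ‖ := by
      have hsq : ‖1 + I * Complex.sqrt ζ‖ ^ 2 = ‖1 - I * Complex.sqrt ζ‖ ^ 2 := by
        rw [← Complex.normSq_eq_norm_sq, ← Complex.normSq_eq_norm_sq, hv, h1, h2]; ring
      exact (pow_left_inj₀ (norm_nonneg _) (norm_nonneg _) two_ne_zero).1 hsq
    rw [this, div_self (norm_ne_zero_iff.2 (one_sub_I_mul_sqrt_ne_zero ζ)), mul_one]
  · rw [h3]
    exact div_nonneg (mul_nonneg hP.le (mul_nonneg zero_le_two (Real.sqrt_nonneg _)))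
      (Complex.normSq_nonneg _)

/-- **The half plane configuration is majorised by the half disk configuration**:
`d_ℍ([-μ², -μ⁻²], [0, ∞)) ≤ d_{S(P)}([-2, 2], half circle minus -P)` (transport by `F_P`).
[folklore] -/
theorem extremalDistance_halfPlane_le_halfDisk (hP : 2 < P) :
    extremalDistance upperHalfPlaneSet
        (Icc (-((P + 2) / (P - 2)) ^ 2) (-((P - 2) / (P + 2)) ^ 2) ×ℂ {0}) (Ici 0 ×ℂ {0}) ≤
      extremalDistance (upperHalfDisk P) (Icc (-2) 2 ×ℂ {0}) (upperArc P \ {-(P : ℂ)}) := by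
  have hP0 : 0 < P := by linarith
  refine extremalDistance_le_of_mapsTo (isOpen_upperHalfDisk P) (differentiableOn_halfDiskToHalfPlane P)
    (injOn_halfDiskToHalfPlane hP0) (continuousOn_halfDiskToHalfPlane ?_) (halfDiskToHalfPlane_image hP0)
    (halfDiskToHalfPlane_mapsTo_segment hP) (halfDiskToHalfPlane_mapsTo_arc P)
  rintro w ((hw | hw) | hw)
  · rw [mem_reProdIm, mem_singleton_iff] at hw
    intro h
    have := congrArg Complex.re h
    simp at this
    linarith [hw.1.1]
  · intro h
    exact hw.2 (by rw [mem_singleton_iff]; linear_combination h)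
  · exact ofReal_add_ne_zero_of_im_pos P hw.2

/-- **The half disk configuration is majorised by the half plane configuration**:
`d_{S(P)}([-2, 2], half circle) ≤ d_ℍ([-μ², -μ⁻²], [0, ∞))` (transport by `f_P`). [folklore] -/
theorem extremalDistance_halfDisk_le_halfPlane (hP : 2 < P) :
    extremalDistance (upperHalfDisk P) (Icc (-2) 2 ×ℂ {0}) (upperArc P) ≤
      extremalDistance upperHalfPlaneSet
        (Icc (-((P + 2) / (P - 2)) ^ 2) (-((P - 2) / (P + 2)) ^ 2) ×ℂ {0}) (Ici 0 ×ℂ {0}) := by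
  have hP0 : 0 < P := by linarith
  refine extremalDistance_le_of_mapsTo UpperHalfPlane.isOpen_upperHalfPlaneSet
    (differentiableOn_halfPlaneToHalfDisk P) (injective_halfPlaneToHalfDisk hP0.ne').injOn
    ((continuousOn_halfPlaneToHalfDisk P).mono ?_) (halfPlaneToHalfDisk_image hP0)
    (halfPlaneToHalfDisk_mapsTo_segment hP) (halfPlaneToHalfDisk_mapsTo_arc hP0)
  rintro ζ ((hζ | hζ) | hζ)
  · rw [mem_reProdIm, mem_singleton_iff] at hζ
    exact hζ.2.ge
  · rw [mem_reProdIm, mem_singleton_iff] at hζ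
    exact hζ.2.ge
  · exact le_of_lt (show 0 < ζ.im from hζ)

end HalfDiskMap

/-! ### Real affine changes of variable in the half plane -/

/-- A real affine map `z ↦ k z + b` (`k > 0`, `b ∈ ℝ`) is a conformal automorphism of the upper
half plane continuous on `ℂ`; extremal distances in the half plane are transported along it.
[folklore] -/
theorem extremalDistance_halfPlane_affine_le {k b : ℝ} (hk : 0 < k) {E₁ E₂ E₁' E₂' : Set ℂ}
    (h₁ : MapsTo (fun z : ℂ ↦ (k : ℂ) * z + b) E₁ E₁')
    (h₂ : MapsTo (fun z : ℂ ↦ (k : ℂ) * z + b) E₂ E₂') :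
    extremalDistance upperHalfPlaneSet E₁' E₂' ≤ extremalDistance upperHalfPlaneSet E₁ E₂ := by
  have hk' : (k : ℂ) ≠ 0 := Complex.ofReal_ne_zero.2 hk.ne'
  refine extremalDistance_le_of_mapsTo UpperHalfPlane.isOpen_upperHalfPlaneSet
    (by fun_prop) ?_ (by fun_prop) ?_ h₁ h₂
  · intro z₁ _ z₂ _ h
    have h' : (k : ℂ) * z₁ = (k : ℂ) * z₂ := add_right_cancel h
    exact mul_left_cancel₀ hk' h'
  · ext ζ
    constructor
    · rintro ⟨z, hz, rfl⟩
      show 0 < ((k : ℂ) * z + b).im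
      have hz' : 0 < z.im := hz
      simp only [add_im, mul_im, ofReal_re, ofReal_im, zero_mul, add_zero]
      positivity
    · intro hζ
      have hζ' : 0 < ζ.im := hζ
      refine ⟨(ζ - b) / k, ?_, ?_⟩
      · show 0 < ((ζ - b) / k).im
        rw [div_ofReal_im, sub_im, ofReal_im, sub_zero]
        positivity
      · simp only
        rw [mul_div_cancel₀ _ hk', sub_add_cancel]

/-- A real affine map `x ↦ k x + b` acting on subsets of the real axis. [folklore] -/
theorem affine_mapsTo_reProdIm {k b : ℝ} {S T : Set ℝ} (h : ∀ x ∈ S, k * x + b ∈ T) :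
    MapsTo (fun z : ℂ ↦ (k : ℂ) * z + b) (S ×ℂ {0}) (T ×ℂ {0}) := by
  intro z hz
  rw [mem_reProdIm, mem_singleton_iff] at hz ⊢
  have hz' : z = (z.re : ℂ) := Complex.ext rfl (by simp [hz.2])
  rw [hz']
  simp only
  rw [← ofReal_mul, ← ofReal_add, ofReal_re, ofReal_im]
  exact ⟨h _ hz.1, rfl⟩

end ExtremalLength

/-! ### Proof of the named fact -/

/-- **Ahlfors's double inequality (4-21) for the extremal distance in the half plane**
(Ahlfors (1973), §4-12, (4-21) p. 76, with §4-11 for `d = 2Λ(R)`): for `e₂ < e₃ < e₁` and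
`R = (e₁ - e₃)/(e₃ - e₂)`, the extremal distance `d` between `[e₂, e₃]` and `[e₁, +∞)` with
respect to the upper half plane satisfies `log (16 R) / π ≤ d ≤ log (16 (R + 1)) / π`. Discharges
the named fact `halfPlane_extremalDistance_log_bounds`; the (elementary) proof is described in
the module docstring. [cite: Ahlfors1973CI, §4-12 (4-21) p. 76] -/
theorem halfPlane_extremalDistance_log_bounds_holds : halfPlane_extremalDistance_log_bounds := by
  intro e₂ e₃ e₁ h23 h31
  have hs : 0 < e₁ - e₃ := sub_pos.2 h31
  have ht : 0 < e₃ - e₂ := sub_pos.2 h23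
  -- the modulus parameter `μ`, `μ⁴ = (e₁ - e₂)/(e₁ - e₃)`
  obtain ⟨Q, hQ⟩ : ∃ Q : ℝ, Q = (e₁ - e₂) / (e₁ - e₃) := ⟨_, rfl⟩
  have hQ1 : 1 < Q := by
    rw [hQ, lt_div_iff₀ hs]; linarith
  obtain ⟨μ, hμ⟩ : ∃ μ : ℝ, μ = Real.sqrt (Real.sqrt Q) := ⟨_, rfl⟩
  have hsQ1 : 1 < Real.sqrt Q := by
    rw [← Real.sqrt_one]; exact Real.sqrt_lt_sqrt zero_le_one hQ1
  have hμ1 : 1 < μ := by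
    rw [hμ, ← Real.sqrt_one]; exact Real.sqrt_lt_sqrt zero_le_one hsQ1
  have hμ0 : 0 < μ := one_pos.trans hμ1
  have hμ2 : μ ^ 2 = Real.sqrt Q := by
    rw [hμ, Real.sq_sqrt (Real.sqrt_nonneg _)]
  have hμ4 : μ ^ 4 = Q := by
    rw [show μ ^ 4 = (μ ^ 2) ^ 2 by ring, hμ2, Real.sq_sqrt (by linarith)]
  have hμ41 : 0 < μ ^ 4 - 1 := by rw [hμ4]; linarith
  have hR : (e₁ - e₃) / (e₃ - e₂) = 1 / (μ ^ 4 - 1) := by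
    rw [hμ4, hQ, div_sub_one hs.ne', one_div_div]
    congr 1
    ring
  -- the half disk radius `P`, `(P + 2)/(P - 2) = μ`
  obtain ⟨P, hP⟩ : ∃ P : ℝ, P = 2 * (μ + 1) / (μ - 1) := ⟨_, rfl⟩
  have hμm : 0 < μ - 1 := sub_pos.2 hμ1
  have hP2 : 2 < P := by
    rw [hP, lt_div_iff₀ hμm]; linarith
  have hP2ne : P - 2 ≠ 0 := by linarith
  have hμP : (P + 2) / (P - 2) = μ := by
    rw [div_eq_iff hP2ne, hP]
    field_simp
    ring
  have hμP' : (P - 2) / (P + 2) = μ⁻¹ := by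
    rw [← inv_div, hμP]
  -- the bounds in the normal form `(ℍ; -μ², -μ⁻², 0, ∞)`
  have hLB := (le_extremalDistance_upperHalfDisk hP2).trans
    (extremalDistance_halfDisk_le_halfPlane hP2)
  have hUB := (extremalDistance_halfPlane_le_halfDisk hP2).trans
    (extremalDistance_upperHalfDisk_le hP2)
  rw [hμP, hμP'] at hLB hUB
  -- affine transport between `(e₂, e₃, e₁)` and `(-μ², -μ⁻², 0)`
  have hk0 : 0 < μ ^ 2 * (e₁ - e₃) := by positivity
  have he12 : e₁ - e₂ = μ ^ 4 * (e₁ - e₃) := by rw [hμ4, hQ, div_mul_cancel₀ _ hs.ne']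
  have hA : extremalDistance upperHalfPlaneSet (Icc (-μ ^ 2) (-μ⁻¹ ^ 2) ×ℂ {0}) (Ici 0 ×ℂ {0}) ≤
      extremalDistance upperHalfPlaneSet (Icc e₂ e₃ ×ℂ {0}) (Ici e₁ ×ℂ {0}) := by
    refine extremalDistance_halfPlane_affine_le (k := (μ ^ 2 * (e₁ - e₃))⁻¹)
      (b := -((μ ^ 2 * (e₁ - e₃))⁻¹ * e₁)) (inv_pos.2 hk0) (affine_mapsTo_reProdIm ?_)
      (affine_mapsTo_reProdIm ?_)
    · rintro x ⟨hx1, hx2⟩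
      rw [show (μ ^ 2 * (e₁ - e₃))⁻¹ * x + -((μ ^ 2 * (e₁ - e₃))⁻¹ * e₁) =
        (x - e₁) * (μ ^ 2 * (e₁ - e₃))⁻¹ by ring]
      constructor
      · calc -μ ^ 2 = -(e₁ - e₂) * (μ ^ 2 * (e₁ - e₃))⁻¹ := by
              rw [he12]; field_simp
          _ ≤ (x - e₁) * (μ ^ 2 * (e₁ - e₃))⁻¹ :=
              mul_le_mul_of_nonneg_right (by linarith) (inv_pos.2 hk0).le
      · calc (x - e₁) * (μ ^ 2 * (e₁ - e₃))⁻¹ ≤ -(e₁ - e₃) * (μ ^ 2 * (e₁ - e₃))⁻¹ :=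
              mul_le_mul_of_nonneg_right (by linarith) (inv_pos.2 hk0).le
          _ = -μ⁻¹ ^ 2 := by field_simp
    · intro x hx
      rw [mem_Ici] at hx ⊢
      rw [show (μ ^ 2 * (e₁ - e₃))⁻¹ * x + -((μ ^ 2 * (e₁ - e₃))⁻¹ * e₁) =
        (x - e₁) * (μ ^ 2 * (e₁ - e₃))⁻¹ by ring]
      exact mul_nonneg (by linarith) (inv_pos.2 hk0).le
  have hB : extremalDistance upperHalfPlaneSet (Icc e₂ e₃ ×ℂ {0}) (Ici e₁ ×ℂ {0}) ≤
      extremalDistance upperHalfPlaneSet (Icc (-μ ^ 2) (-μ⁻¹ ^ 2) ×ℂ {0}) (Ici 0 ×ℂ {0}) := by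
    refine extremalDistance_halfPlane_affine_le (k := μ ^ 2 * (e₁ - e₃)) (b := e₁) hk0
      (affine_mapsTo_reProdIm ?_) (affine_mapsTo_reProdIm ?_)
    · rintro ξ ⟨hξ1, hξ2⟩
      constructor
      · have h1 : μ ^ 2 * (e₁ - e₃) * (-μ ^ 2) ≤ μ ^ 2 * (e₁ - e₃) * ξ :=
          mul_le_mul_of_nonneg_left hξ1 hk0.le
        have h2 : μ ^ 2 * (e₁ - e₃) * (-μ ^ 2) = -(e₁ - e₂) := by rw [he12]; ring
        linarith
      · have h1 : μ ^ 2 * (e₁ - e₃) * ξ ≤ μ ^ 2 * (e₁ - e₃) * (-μ⁻¹ ^ 2) :=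
          mul_le_mul_of_nonneg_left hξ2 hk0.le
        have h2 : μ ^ 2 * (e₁ - e₃) * (-μ⁻¹ ^ 2) = -(e₁ - e₃) := by field_simp
        linarith
    · intro ξ hξ
      rw [mem_Ici] at hξ ⊢
      nlinarith [mul_nonneg hk0.le hξ]
  -- the real inequalities `16 R ≤ ρ⁻` and `ρ⁺ ≤ 16 (R + 1)`
  have hkey1 : 0 ≤ (μ - 1) ^ 2 * (μ ^ 3 + 5 * μ ^ 2 + 9 * μ + 13) := by positivity
  have hkey2 : 0 ≤ (μ - 1) ^ 2 * (13 * μ ^ 3 + 9 * μ ^ 2 + 5 * μ + 1) := by positivity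
  have hPm1 : P - 1 = (μ + 3) / (μ - 1) := by rw [hP, div_sub_one hμm.ne']; ring
  have hPp1 : P + 1 = (3 * μ + 1) / (μ - 1) := by rw [hP, div_add_one hμm.ne']; ring
  have h16 : 16 * (1 / (μ ^ 4 - 1)) ≤ (P + Real.sqrt (P ^ 2 - 4)) / 2 := by
    have h1 : 16 * (1 / (μ ^ 4 - 1)) ≤ P - 1 := by
      rw [hPm1, mul_one_div, div_le_div_iff₀ hμ41 hμm]
      nlinarith
    have h2 : P - 2 ≤ Real.sqrt (P ^ 2 - 4) :=
      calc P - 2 = Real.sqrt ((P - 2) ^ 2) := (Real.sqrt_sq (by linarith)).symm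
        _ ≤ Real.sqrt (P ^ 2 - 4) := Real.sqrt_le_sqrt (by nlinarith)
    linarith
  have h16' : (P + Real.sqrt (P ^ 2 + 4)) / 2 ≤ 16 * (1 / (μ ^ 4 - 1) + 1) := by
    have h1 : P + 1 ≤ 16 * (1 / (μ ^ 4 - 1) + 1) := by
      rw [hPp1, div_add_one hμ41.ne', ← mul_div_assoc, div_le_div_iff₀ hμm hμ41]
      nlinarith
    have h2 : Real.sqrt (P ^ 2 + 4) ≤ P + 2 :=
      calc Real.sqrt (P ^ 2 + 4) ≤ Real.sqrt ((P + 2) ^ 2) := Real.sqrt_le_sqrt (by nlinarith)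
        _ = P + 2 := Real.sqrt_sq (by linarith)
    linarith
  have hρp : 0 < (P + Real.sqrt (P ^ 2 + 4)) / 2 := by
    have := Real.sqrt_nonneg (P ^ 2 + 4); linarith
  rw [hR]
  constructor
  · calc ENNReal.ofReal (Real.log (16 * (1 / (μ ^ 4 - 1))) / π)
        ≤ ENNReal.ofReal (Real.log ((P + Real.sqrt (P ^ 2 - 4)) / 2) / π) :=
          ENNReal.ofReal_le_ofReal (div_le_div_of_nonneg_right
            (Real.log_le_log (mul_pos (by norm_num) (one_div_pos.2 hμ41)) h16) Real.pi_pos.le)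
      _ ≤ _ := hLB.trans hA
  · calc extremalDistance upperHalfPlaneSet (Icc e₂ e₃ ×ℂ {0}) (Ici e₁ ×ℂ {0})
        ≤ ENNReal.ofReal (Real.log ((P + Real.sqrt (P ^ 2 + 4)) / 2) / π) := hB.trans hUB
      _ ≤ ENNReal.ofReal (Real.log (16 * (1 / (μ ^ 4 - 1) + 1)) / π) :=
          ENNReal.ofReal_le_ofReal (div_le_div_of_nonneg_right
            (Real.log_le_log hρp h16') Real.pi_pos.le)

end Literature.Analysis.Complex

end
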